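import Summits.AnomalousDissipation.AnomalousDissipation.Theorems.SolenoidalFractalHomogenisationRealisedQuasiStaticCellLawComovingPairWeights
import HarnessLib

/-!
# K2R `RealisedQuasiStaticCellLaw`, line `floquet-bloch`, stub `stub_lowSectorDecay` (S1D): the co-moving pair weights
# (W-near regime) — transport matrices, start, junctions, end (metric reset), upper bound

Summits-side helper file (everything proved; no definitions, no named facts; `--supports stmt-AnomalousDissipation-20446`).
The EXPLICIT weights of the joint slow form consumed by `isoSector_decay_ae`: in slot `j` of period `q`, with
`r = t − (qP + start j)`, `I_k(r) = Λ_j(d₀,j r + σ_k,j g₁,j² ∫₀ʳ trapezoid²)` (`k = o, i`), the frame-`0` transport matrices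
`C_j` (`C₀ = 1`, `C_{j+1} = C_j R_jᵀ diag(e^{X_o,j}, e^{X_i,j}) R_j`, `R_j = [[rc_j, rs_j],[−rs_j, rc_j]]` the frame rotation
of slot `j`, `X_k,j = I_k(τ_j)` the full-slot nominal exponents) supplied as four real sequences with their recursion, and
`v₁ = C_jR_jᵀe₁`, `v₂ = C_jR_jᵀe₂`:
`a = e^{−2λ̄(t−qP) + 2I_o}|v₁|²`, `b = e^{−2λ̄(t−qP) + 2I_i}|v₂|²`, `c = e^{−2λ̄(t−qP) + I_o + I_i} v₁·v₂`.
Proved here: the co-moving derivative identities (`comoving_hwa/hwb/hwc`), the lower bound `G ≥ e^{−2λ̄P}`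
(`comoving_hG`, from expansiveness of the `C_j`, `comoving_expansive`), the START identity (`comoving_start`) and the END
inequality from an expansion bound on `C_{k₀}` (`comoving_end`) — the latter is where the near-commuting product estimate
and the isotropy of the word enter at the arithmetic level.
-/

set_option linter.dupNamespace false

noncomputable section

namespace Summit.AnomalousDissipation.AnomalousDissipation.Theorems.SolenoidalFractalHomogenisation.RealisedQuasiStaticCellLaw

open Set MeasureTheory Filter Topology Function Complex
open scoped ComplexConjugate
open Literature.Analysis.FluidPDE Literature.Analysis.FluidPDE.LatticeShear
open Summit.AnomalousDissipation.AnomalousDissipation.Theorems.SolenoidalFractalHomogenisation.PermissibleCarrier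

variable {k₀ : ℕ}

/-- **START: at the beginning of a period the joint form is the identity** (`C₀ = 1`, all exponents vanish). -/
theorem comoving_start (W : LatticeWord k₀) (Λ d0 σo σi g₁ rc rs : Fin k₀ → ℝ) (lam : ℝ) (c₁₁ c₁₂ c₂₁ c₂₂ : ℕ → ℝ)
    (hrot : ∀ j, rc j ^ 2 + rs j ^ 2 = 1) (hC0 : c₁₁ 0 = 1 ∧ c₁₂ 0 = 0 ∧ c₂₁ 0 = 0 ∧ c₂₂ 0 = 1) :
    ∀ q : ℕ, ∀ x₁ x₂ : ℂ,
      Real.exp (-(2 * lam * (((q : ℝ) * W.period + W.start (⟨0, W.pos⟩ : Fin k₀)) - (q : ℝ) * W.period)) + 2 * (Λ (⟨0, W.pos⟩ : Fin k₀) * (d0 (⟨0, W.pos⟩ : Fin k₀) * (((q : ℝ) * W.period + W.start (⟨0, W.pos⟩ : Fin k₀)) - ((q : ℝ) * W.period + W.start (⟨0, W.pos⟩ : Fin k₀))) + σo (⟨0, W.pos⟩ : Fin k₀) * g₁ (⟨0, W.pos⟩ : Fin k₀) ^ 2 * (∫ s in (0:ℝ)..(((q : ℝ) * W.period + W.start (⟨0,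 W.pos⟩ : Fin k₀)) - ((q : ℝ) * W.period + W.start (⟨0, W.pos⟩ : Fin k₀))), LatticeWord.trapezoid 0 (W.phase (⟨0, W.pos⟩ : Fin k₀)).τ W.ramp s ^ 2)))) * ((c₁₁ (⟨0, W.pos⟩ : Fin k₀) * rc (⟨0, W.pos⟩ : Fin k₀) + c₁₂ (⟨0, W.pos⟩ : Fin k₀) * rs (⟨0, W.pos⟩ : Fin k₀)) ^ 2 + (c₂₁ (⟨0, W.pos⟩ : Fin k₀) * rc (⟨0, W.pos⟩ : Fin k₀) + c₂₂ (⟨0, W.pos⟩ : Fin k₀) * rs (⟨0, W.pos⟩ : Fin k₀)) ^ 2) * ‖(rc (⟨0, W.pos⟩ : Fin k₀) : ℂ) * x₁ + (rs (⟨0, W.pos⟩ : Fin k₀) : ℂ) * x₂‖ ^ 2 +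
          Real.exp (-(2 * lam * (((q : ℝ) * W.period + W.start (⟨0, W.pos⟩ : Fin k₀)) - (q : ℝ) * W.period)) + 2 * (Λ (⟨0, W.pos⟩ : Fin k₀) * (d0 (⟨0, W.pos⟩ : Fin k₀) * (((q : ℝ) * W.period + W.start (⟨0, W.pos⟩ : Fin k₀)) - ((q : ℝ) * W.period + W.start (⟨0, W.pos⟩ : Fin k₀))) + σi (⟨0, W.pos⟩ : Fin k₀) * g₁ (⟨0, W.pos⟩ : Fin k₀) ^ 2 * (∫ s in (0:ℝ)..(((q : ℝ) * W.period + W.start (⟨0, W.pos⟩ : Fin k₀)) - ((q : ℝ) * W.period + W.start (⟨0, W.pos⟩ : Fin k₀))), LatticeWord.trapezoid 0 (W.phase (⟨0, W.pos⟩ : Fin k₀)).τ W.ramp s ^ 2)))) * ((-(c₁₁ (⟨0, W.pos⟩ : Fin k₀) * rs (⟨0, W.pos⟩ : Fin k₀)) + c₁₂ (⟨0, W.pos⟩ : Fin k₀) * rc (⟨0, W.pos⟩ : Fin k₀)) ^ 2 + (-(c₂₁ (⟨0, W.pos⟩ : Fin k₀) * rs (⟨0, W.pos⟩ : Fin k₀))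 + c₂₂ (⟨0, W.pos⟩ : Fin k₀) * rc (⟨0, W.pos⟩ : Fin k₀)) ^ 2) * ‖-(rs (⟨0, W.pos⟩ : Fin k₀) : ℂ) * x₁ + (rc (⟨0, W.pos⟩ : Fin k₀) : ℂ) * x₂‖ ^ 2 +
          2 * ((((Real.exp (-(2 * lam * (((q : ℝ) * W.period + W.start (⟨0, W.pos⟩ : Fin k₀)) - (q : ℝ) * W.period)) + (Λ (⟨0, W.pos⟩ : Fin k₀) * (d0 (⟨0, W.pos⟩ : Fin k₀) * (((q : ℝ) * W.period + W.start (⟨0, W.pos⟩ : Fin k₀)) - ((q : ℝ) * W.period + W.start (⟨0, W.pos⟩ : Fin k₀))) + σo (⟨0, W.pos⟩ : Fin k₀) * g₁ (⟨0, W.pos⟩ : Fin k₀) ^ 2 * (∫ s in (0:ℝ)..(((q : ℝ) * W.period + W.start (⟨0, W.pos⟩ : Fin k₀)) - ((q : ℝ) * W.period + W.start (⟨0, W.pos⟩ : Fin k₀))), LatticeWord.trapezoid 0 (W.phase (⟨0, W.pos⟩ : Fin k₀)).τ W.ramp s ^ 2))) + (Λ (⟨0, W.pos⟩ : Fin k₀)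 * (d0 (⟨0, W.pos⟩ : Fin k₀) * (((q : ℝ) * W.period + W.start (⟨0, W.pos⟩ : Fin k₀)) - ((q : ℝ) * W.period + W.start (⟨0, W.pos⟩ : Fin k₀))) + σi (⟨0, W.pos⟩ : Fin k₀) * g₁ (⟨0, W.pos⟩ : Fin k₀) ^ 2 * (∫ s in (0:ℝ)..(((q : ℝ) * W.period + W.start (⟨0, W.pos⟩ : Fin k₀)) - ((q : ℝ) * W.period + W.start (⟨0, W.pos⟩ : Fin k₀))), LatticeWord.trapezoid 0 (W.phase (⟨0, W.pos⟩ : Fin k₀)).τ W.ramp s ^ 2)))) * ((c₁₁ (⟨0, W.pos⟩ : Fin k₀) * rc (⟨0, W.pos⟩ : Fin k₀) + c₁₂ (⟨0, W.pos⟩ : Fin k₀) * rs (⟨0, W.pos⟩ : Fin k₀)) * (-(c₁₁ (⟨0, W.pos⟩ : Fin k₀) * rs (⟨0, W.pos⟩ : Fin k₀)) + c₁₂ (⟨0, W.pos⟩ : Fin k₀) * rc (⟨0, W.pos⟩ : Fin k₀)) + (c₂₁ (⟨0, W.pos⟩ : Fin k₀) * rc (⟨0, W.pos⟩ : Fin k₀)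 + c₂₂ (⟨0, W.pos⟩ : Fin k₀) * rs (⟨0, W.pos⟩ : Fin k₀)) * (-(c₂₁ (⟨0, W.pos⟩ : Fin k₀) * rs (⟨0, W.pos⟩ : Fin k₀)) + c₂₂ (⟨0, W.pos⟩ : Fin k₀) * rc (⟨0, W.pos⟩ : Fin k₀)))) : ℝ) : ℂ) * conj ((rc (⟨0, W.pos⟩ : Fin k₀) : ℂ) * x₁ + (rs (⟨0, W.pos⟩ : Fin k₀) : ℂ) * x₂) * (-(rs (⟨0, W.pos⟩ : Fin k₀) : ℂ) * x₁ + (rc (⟨0, W.pos⟩ : Fin k₀) : ℂ) * x₂)).re ≤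
        ‖x₁‖ ^ 2 + ‖x₂‖ ^ 2 := by
  intro q x₁ x₂
  have hst0 : W.start (⟨0, W.pos⟩ : Fin k₀) = 0 := by rw [start_eq_sum_range W 0 W.pos]; simp
  have hval : (((⟨0, W.pos⟩ : Fin k₀) : ℕ)) = 0 := rfl
  rw [hval, hC0.1, hC0.2.1, hC0.2.2.1, hC0.2.2.2, sub_self, intervalIntegral.integral_same, hst0]
  simp only [mul_zero, add_zero, sub_self, neg_zero, zero_add, Real.exp_zero, one_mul, zero_mul]
  have e1 : rc (⟨0, W.pos⟩ : Fin k₀) ^ 2 + rs (⟨0, W.pos⟩ : Fin k₀) ^ 2 = 1 := hrot _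
  have e2 : (-rs (⟨0, W.pos⟩ : Fin k₀)) ^ 2 + rc (⟨0, W.pos⟩ : Fin k₀) ^ 2 = 1 := by rw [neg_sq]; linarith [hrot (⟨0, W.pos⟩ : Fin k₀)]
  have e3 : rc (⟨0, W.pos⟩ : Fin k₀) * -rs (⟨0, W.pos⟩ : Fin k₀) + rs (⟨0, W.pos⟩ : Fin k₀) * rc (⟨0, W.pos⟩ : Fin k₀) = 0 := by ring
  rw [e1, e2, e3]
  simp only [one_mul, Complex.ofReal_zero, zero_mul, Complex.zero_re, mul_zero, add_zero]
  exact (rot_norm_sq _ _ (hrot (⟨0, W.pos⟩ : Fin k₀)) x₁ x₂).le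

/-- **END (metric reset)**: if the full-period transport `C_{k₀}` expands by `e^{λ̄P}`, the joint form at the end of the
last slot dominates the identity. -/
theorem comoving_end (W : LatticeWord k₀) (Λ d0 σo σi g₁ rc rs : Fin k₀ → ℝ) (lam : ℝ) (c₁₁ c₁₂ c₂₁ c₂₂ : ℕ → ℝ)
    (hCsucc : ∀ j : Fin k₀, c₁₁ ((j : ℕ) + 1) = c₁₁ j * (rc j ^ 2 * Real.exp (Λ j * (d0 j * (W.phase j).τ + σo j * g₁ j ^ 2 * ((W.phase j).τ * (1 - 4 * W.ramp / 3)))) + rs j ^ 2 * Real.exp (Λ j * (d0 j * (W.phase j).τ + σi j * g₁ j ^ 2 * ((W.phase j).τ * (1 - 4 * W.ramp / 3))))) + c₁₂ j * (rc j * rs j * (Real.exp (Λ j * (d0 j * (W.phase j).τ + σo j * g₁ j ^ 2 * ((W.phase j).τ * (1 - 4 * W.ramp / 3)))) - Real.exp (Λ j * (d0 j * (W.phase j).τ + σi j * g₁ j ^ 2 * ((W.phase j).τ * (1 - 4 * W.ramp / 3)))))) ∧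
        c₁₂ ((j : ℕ) + 1) = c₁₁ j * (rc j * rs j * (Real.exp (Λ j * (d0 j * (W.phase j).τ + σo j * g₁ j ^ 2 * ((W.phase j).τ * (1 - 4 * W.ramp / 3)))) - Real.exp (Λ j * (d0 j * (W.phase j).τ + σi j * g₁ j ^ 2 * ((W.phase j).τ * (1 - 4 * W.ramp / 3)))))) + c₁₂ j * (rs j ^ 2 * Real.exp (Λ j * (d0 j * (W.phase j).τ + σo j * g₁ j ^ 2 * ((W.phase j).τ * (1 - 4 * W.ramp / 3)))) + rc j ^ 2 * Real.exp (Λ j * (d0 j * (W.phase j).τ + σi j * g₁ j ^ 2 * ((W.phase j).τ * (1 - 4 * W.ramp / 3))))) ∧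
        c₂₁ ((j : ℕ) + 1) = c₂₁ j * (rc j ^ 2 * Real.exp (Λ j * (d0 j * (W.phase j).τ + σo j * g₁ j ^ 2 * ((W.phase j).τ * (1 - 4 * W.ramp / 3)))) + rs j ^ 2 * Real.exp (Λ j * (d0 j * (W.phase j).τ + σi j * g₁ j ^ 2 * ((W.phase j).τ * (1 - 4 * W.ramp / 3))))) + c₂₂ j * (rc j * rs j * (Real.exp (Λ j * (d0 j * (W.phase j).τ + σo j * g₁ j ^ 2 * ((W.phase j).τ * (1 - 4 * W.ramp / 3)))) - Real.exp (Λ j * (d0 j * (W.phase j).τ + σi j * g₁ j ^ 2 * ((W.phase j).τ * (1 - 4 * W.ramp / 3)))))) ∧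
        c₂₂ ((j : ℕ) + 1) = c₂₁ j * (rc j * rs j * (Real.exp (Λ j * (d0 j * (W.phase j).τ + σo j * g₁ j ^ 2 * ((W.phase j).τ * (1 - 4 * W.ramp / 3)))) - Real.exp (Λ j * (d0 j * (W.phase j).τ + σi j * g₁ j ^ 2 * ((W.phase j).τ * (1 - 4 * W.ramp / 3)))))) + c₂₂ j * (rs j ^ 2 * Real.exp (Λ j * (d0 j * (W.phase j).τ + σo j * g₁ j ^ 2 * ((W.phase j).τ * (1 - 4 * W.ramp / 3)))) + rc j ^ 2 * Real.exp (Λ j * (d0 j * (W.phase j).τ + σi j * g₁ j ^ 2 * ((W.phase j).τ * (1 - 4 * W.ramp / 3))))))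
    (hEND : ∀ z₁ z₂ : ℝ, Real.exp (2 * lam * W.period) * (z₁ ^ 2 + z₂ ^ 2) ≤
      (c₁₁ k₀ * z₁ + c₁₂ k₀ * z₂) ^ 2 + (c₂₁ k₀ * z₁ + c₂₂ k₀ * z₂) ^ 2) :
    ∀ q : ℕ, ∀ x₁ x₂ : ℂ,
      ‖x₁‖ ^ 2 + ‖x₂‖ ^ 2 ≤
        Real.exp (-(2 * lam * (((q : ℝ) * W.period + W.start (⟨k₀ - 1, Nat.sub_lt W.pos one_pos⟩ : Fin k₀) + (W.phase (⟨k₀ - 1, Nat.sub_lt W.pos one_pos⟩ : Fin k₀)).τ) - (q : ℝ) * W.period)) + 2 * (Λ (⟨k₀ - 1, Nat.sub_lt W.pos one_pos⟩ : Fin k₀) * (d0 (⟨k₀ - 1, Nat.sub_lt W.pos one_pos⟩ : Fin k₀) * (((q : ℝ) * W.period + W.start (⟨k₀ - 1, Nat.sub_lt W.pos one_pos⟩ : Fin k₀) + (W.phase (⟨k₀ - 1, Nat.sub_lt W.pos one_pos⟩ : Fin k₀)).τ) - ((q : ℝ) * W.period + W.start (⟨k₀ - 1, Nat.sub_lt W.pos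 one_pos⟩ : Fin k₀))) + σo (⟨k₀ - 1, Nat.sub_lt W.pos one_pos⟩ : Fin k₀) * g₁ (⟨k₀ - 1, Nat.sub_lt W.pos one_pos⟩ : Fin k₀) ^ 2 * (∫ s in (0:ℝ)..(((q : ℝ) * W.period + W.start (⟨k₀ - 1, Nat.sub_lt W.pos one_pos⟩ : Fin k₀) + (W.phase (⟨k₀ - 1, Nat.sub_lt W.pos one_pos⟩ : Fin k₀)).τ) - ((q : ℝ) * W.period + W.start (⟨k₀ - 1, Nat.sub_lt W.pos one_pos⟩ : Fin k₀))), LatticeWord.trapezoid 0 (W.phase (⟨k₀ - 1, Nat.sub_lt W.pos one_pos⟩ : Fin k₀)).τ W.ramp s ^ 2)))) * ((c₁₁ (⟨k₀ - 1, Nat.sub_lt W.pos one_pos⟩ : Fin k₀) * rc (⟨k₀ - 1, Nat.sub_lt W.pos one_pos⟩ : Fin k₀) + c₁₂ (⟨k₀ - 1, Nat.sub_lt W.pos one_pos⟩ : Fin k₀) * rs (⟨k₀ - 1, Nat.sub_lt W.pos one_pos⟩ : Fin k₀)) ^ 2 + (c₂₁ (⟨k₀ - 1, Nat.sub_lt W.pos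 one_pos⟩ : Fin k₀) * rc (⟨k₀ - 1, Nat.sub_lt W.pos one_pos⟩ : Fin k₀) + c₂₂ (⟨k₀ - 1, Nat.sub_lt W.pos one_pos⟩ : Fin k₀) * rs (⟨k₀ - 1, Nat.sub_lt W.pos one_pos⟩ : Fin k₀)) ^ 2) * ‖(rc (⟨k₀ - 1, Nat.sub_lt W.pos one_pos⟩ : Fin k₀) : ℂ) * x₁ + (rs (⟨k₀ - 1, Nat.sub_lt W.pos one_pos⟩ : Fin k₀) : ℂ) * x₂‖ ^ 2 +
          Real.exp (-(2 * lam * (((q : ℝ) * W.period + W.start (⟨k₀ - 1, Nat.sub_lt W.pos one_pos⟩ : Fin k₀) + (W.phase (⟨k₀ - 1, Nat.sub_lt W.pos one_pos⟩ : Fin k₀)).τ) - (q : ℝ) * W.period)) + 2 * (Λ (⟨k₀ - 1, Nat.sub_lt W.pos one_pos⟩ : Fin k₀) * (d0 (⟨k₀ - 1, Nat.sub_lt W.pos one_pos⟩ : Fin k₀) * (((q : ℝ) * W.period + W.start (⟨k₀ - 1, Nat.sub_lt W.pos one_pos⟩ : Fin k₀) + (W.phase (⟨k₀ - 1, Nat.sub_lt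 W.pos one_pos⟩ : Fin k₀)).τ) - ((q : ℝ) * W.period + W.start (⟨k₀ - 1, Nat.sub_lt W.pos one_pos⟩ : Fin k₀))) + σi (⟨k₀ - 1, Nat.sub_lt W.pos one_pos⟩ : Fin k₀) * g₁ (⟨k₀ - 1, Nat.sub_lt W.pos one_pos⟩ : Fin k₀) ^ 2 * (∫ s in (0:ℝ)..(((q : ℝ) * W.period + W.start (⟨k₀ - 1, Nat.sub_lt W.pos one_pos⟩ : Fin k₀) + (W.phase (⟨k₀ - 1, Nat.sub_lt W.pos one_pos⟩ : Fin k₀)).τ) - ((q : ℝ) * W.period + W.start (⟨k₀ - 1, Nat.sub_lt W.pos one_pos⟩ : Fin k₀))), LatticeWord.trapezoid 0 (W.phase (⟨k₀ - 1, Nat.sub_lt W.pos one_pos⟩ : Fin k₀)).τ W.ramp s ^ 2)))) * ((-(c₁₁ (⟨k₀ - 1, Nat.sub_lt W.pos one_pos⟩ : Fin k₀) * rs (⟨k₀ - 1, Nat.sub_lt W.pos one_pos⟩ : Fin k₀)) + c₁₂ (⟨k₀ - 1, Nat.sub_lt W.pos one_pos⟩ : Fin k₀) * rc (⟨k₀ -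 1, Nat.sub_lt W.pos one_pos⟩ : Fin k₀)) ^ 2 + (-(c₂₁ (⟨k₀ - 1, Nat.sub_lt W.pos one_pos⟩ : Fin k₀) * rs (⟨k₀ - 1, Nat.sub_lt W.pos one_pos⟩ : Fin k₀)) + c₂₂ (⟨k₀ - 1, Nat.sub_lt W.pos one_pos⟩ : Fin k₀) * rc (⟨k₀ - 1, Nat.sub_lt W.pos one_pos⟩ : Fin k₀)) ^ 2) * ‖-(rs (⟨k₀ - 1, Nat.sub_lt W.pos one_pos⟩ : Fin k₀) : ℂ) * x₁ + (rc (⟨k₀ - 1, Nat.sub_lt W.pos one_pos⟩ : Fin k₀) : ℂ) * x₂‖ ^ 2 +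
          2 * ((((Real.exp (-(2 * lam * (((q : ℝ) * W.period + W.start (⟨k₀ - 1, Nat.sub_lt W.pos one_pos⟩ : Fin k₀) + (W.phase (⟨k₀ - 1, Nat.sub_lt W.pos one_pos⟩ : Fin k₀)).τ) - (q : ℝ) * W.period)) + (Λ (⟨k₀ - 1, Nat.sub_lt W.pos one_pos⟩ : Fin k₀) * (d0 (⟨k₀ - 1, Nat.sub_lt W.pos one_pos⟩ : Fin k₀) * (((q : ℝ) * W.period + W.start (⟨k₀ - 1, Nat.sub_lt W.pos one_pos⟩ : Fin k₀) + (W.phase (⟨k₀ - 1, Nat.sub_lt W.pos one_pos⟩ : Fin k₀)).τ) - ((q : ℝ) * W.period + W.start (⟨k₀ - 1, Nat.sub_lt W.pos one_pos⟩ : Fin k₀))) + σo (⟨k₀ - 1, Nat.sub_lt W.pos one_pos⟩ : Fin k₀) * g₁ (⟨k₀ - 1, Nat.sub_lt W.pos one_pos⟩ : Fin k₀) ^ 2 * (∫ s in (0:ℝ)..(((q : ℝ) * W.period + W.start (⟨k₀ - 1, Nat.sub_lt W.pos one_pos⟩ : Fin k₀) + (W.phase (⟨k₀ - 1, Nat.sub_lt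 W.pos one_pos⟩ : Fin k₀)).τ) - ((q : ℝ) * W.period + W.start (⟨k₀ - 1, Nat.sub_lt W.pos one_pos⟩ : Fin k₀))), LatticeWord.trapezoid 0 (W.phase (⟨k₀ - 1, Nat.sub_lt W.pos one_pos⟩ : Fin k₀)).τ W.ramp s ^ 2))) + (Λ (⟨k₀ - 1, Nat.sub_lt W.pos one_pos⟩ : Fin k₀) * (d0 (⟨k₀ - 1, Nat.sub_lt W.pos one_pos⟩ : Fin k₀) * (((q : ℝ) * W.period + W.start (⟨k₀ - 1, Nat.sub_lt W.pos one_pos⟩ : Fin k₀) + (W.phase (⟨k₀ - 1, Nat.sub_lt W.pos one_pos⟩ : Fin k₀)).τ) - ((q : ℝ) * W.period + W.start (⟨k₀ - 1, Nat.sub_lt W.pos one_pos⟩ : Fin k₀))) + σi (⟨k₀ - 1, Nat.sub_lt W.pos one_pos⟩ : Fin k₀) * g₁ (⟨k₀ - 1, Nat.sub_lt W.pos one_pos⟩ : Fin k₀) ^ 2 * (∫ s in (0:ℝ)..(((q : ℝ) * W.period + W.start (⟨k₀ - 1, Nat.sub_lt W.pos one_pos⟩ : Fin k₀) + (W.phase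 (⟨k₀ - 1, Nat.sub_lt W.pos one_pos⟩ : Fin k₀)).τ) - ((q : ℝ) * W.period + W.start (⟨k₀ - 1, Nat.sub_lt W.pos one_pos⟩ : Fin k₀))), LatticeWord.trapezoid 0 (W.phase (⟨k₀ - 1, Nat.sub_lt W.pos one_pos⟩ : Fin k₀)).τ W.ramp s ^ 2)))) * ((c₁₁ (⟨k₀ - 1, Nat.sub_lt W.pos one_pos⟩ : Fin k₀) * rc (⟨k₀ - 1, Nat.sub_lt W.pos one_pos⟩ : Fin k₀) + c₁₂ (⟨k₀ - 1, Nat.sub_lt W.pos one_pos⟩ : Fin k₀) * rs (⟨k₀ - 1, Nat.sub_lt W.pos one_pos⟩ : Fin k₀)) * (-(c₁₁ (⟨k₀ - 1, Nat.sub_lt W.pos one_pos⟩ : Fin k₀) * rs (⟨k₀ - 1, Nat.sub_lt W.pos one_pos⟩ : Fin k₀)) + c₁₂ (⟨k₀ - 1, Nat.sub_lt W.pos one_pos⟩ : Fin k₀) * rc (⟨k₀ - 1, Nat.sub_lt W.pos one_pos⟩ : Fin k₀)) + (c₂₁ (⟨k₀ - 1, Nat.sub_lt W.pos one_pos⟩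 : Fin k₀) * rc (⟨k₀ - 1, Nat.sub_lt W.pos one_pos⟩ : Fin k₀) + c₂₂ (⟨k₀ - 1, Nat.sub_lt W.pos one_pos⟩ : Fin k₀) * rs (⟨k₀ - 1, Nat.sub_lt W.pos one_pos⟩ : Fin k₀)) * (-(c₂₁ (⟨k₀ - 1, Nat.sub_lt W.pos one_pos⟩ : Fin k₀) * rs (⟨k₀ - 1, Nat.sub_lt W.pos one_pos⟩ : Fin k₀)) + c₂₂ (⟨k₀ - 1, Nat.sub_lt W.pos one_pos⟩ : Fin k₀) * rc (⟨k₀ - 1, Nat.sub_lt W.pos one_pos⟩ : Fin k₀)))) : ℝ) : ℂ) * conj ((rc (⟨k₀ - 1, Nat.sub_lt W.pos one_pos⟩ : Fin k₀) : ℂ) * x₁ + (rs (⟨k₀ - 1, Nat.sub_lt W.pos one_pos⟩ : Fin k₀) : ℂ) * x₂) * (-(rs (⟨k₀ - 1, Nat.sub_lt W.pos one_pos⟩ : Fin k₀) : ℂ) * x₁ + (rc (⟨k₀ - 1, Nat.sub_lt W.pos one_pos⟩ : Fin k₀) : ℂ) * x₂)).re := by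
  intro q x₁ x₂
  generalize hj : (⟨k₀ - 1, Nat.sub_lt W.pos one_pos⟩ : Fin k₀) = j
  have hjv : (j : ℕ) + 1 = k₀ := by rw [← hj]; exact Nat.sub_add_cancel W.pos
  have hτ := (W.phase j).τ_pos
  have hP : W.start j + (W.phase j).τ = W.period := by
    have hPsum := period_eq_sum_range W
    have e : Finset.range k₀ = Finset.range (k₀ - 1 + 1) := by rw [Nat.sub_add_cancel W.pos]
    rw [e, Finset.sum_range_succ, dif_pos (Nat.sub_lt W.pos one_pos), ← start_eq_sum_range W (k₀ - 1) (Nat.sub_lt W.pos one_pos),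
      hj] at hPsum
    exact hPsum.symm
  have ht1 : ((q : ℝ) * W.period + W.start j + (W.phase j).τ) - ((q : ℝ) * W.period + W.start j) = (W.phase j).τ := by ring
  have ht2 : ((q : ℝ) * W.period + W.start j + (W.phase j).τ) - (q : ℝ) * W.period = W.period := by rw [← hP]; ring
  rw [ht1, ht2, integral_trapezoid_sq hτ W.ramp_pos W.ramp_le]
  obtain ⟨Xo, hXo⟩ : ∃ X : ℝ, X = Λ j * (d0 j * (W.phase j).τ + σo j * g₁ j ^ 2 * ((W.phase j).τ * (1 - 4 * W.ramp / 3))) :=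
    ⟨_, rfl⟩
  obtain ⟨Xi, hXi⟩ : ∃ X : ℝ, X = Λ j * (d0 j * (W.phase j).τ + σi j * g₁ j ^ 2 * ((W.phase j).τ * (1 - 4 * W.ramp / 3))) :=
    ⟨_, rfl⟩
  have hC := hCsucc j
  rw [← hXo, ← hXi] at hC ⊢
  obtain ⟨κ, hκ⟩ : ∃ κ : ℝ, κ = Real.exp (-(lam * W.period)) := ⟨_, rfl⟩
  obtain ⟨Eo, hEo⟩ : ∃ Eo : ℝ, Eo = Real.exp Xo := ⟨_, rfl⟩
  obtain ⟨Ei, hEi⟩ : ∃ Ei : ℝ, Ei = Real.exp Xi := ⟨_, rfl⟩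
  have e1 : Real.exp (-(2 * lam * W.period) + 2 * Xo) = (κ * Eo) ^ 2 := by
    rw [hκ, hEo, mul_pow, ← Real.exp_nat_mul, ← Real.exp_nat_mul, ← Real.exp_add]; congr 1; push_cast; ring
  have e2 : Real.exp (-(2 * lam * W.period) + 2 * Xi) = (κ * Ei) ^ 2 := by
    rw [hκ, hEi, mul_pow, ← Real.exp_nat_mul, ← Real.exp_nat_mul, ← Real.exp_add]; congr 1; push_cast; ring
  have e3 : Real.exp (-(2 * lam * W.period) + Xo + Xi) = (κ * Eo) * (κ * Ei) := by
    rw [hκ, hEo, hEi, show -(2 * lam * W.period) + Xo + Xi = (-(lam * W.period) + Xo) + (-(lam * W.period) + Xi) by ring,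
      Real.exp_add, Real.exp_add, Real.exp_add]
  rw [← hEo, ← hEi] at hC
  rw [e1, e2, e3]
  have hgram := pairForm_gram (κ * Eo * (c₁₁ j * rc j + c₁₂ j * rs j)) (κ * Eo * (c₂₁ j * rc j + c₂₂ j * rs j)) (κ * Ei * (-(c₁₁ j * rs j) + c₁₂ j * rc j)) (κ * Ei * (-(c₂₁ j * rs j) + c₂₂ j * rc j))
    ((rc j : ℂ) * x₁ + (rs j : ℂ) * x₂) (-(rs j : ℂ) * x₁ + (rc j : ℂ) * x₂)
  have eA : (κ * Eo) ^ 2 * ((c₁₁ j * rc j + c₁₂ j * rs j) ^ 2 + (c₂₁ j * rc j + c₂₂ j * rs j) ^ 2) = (κ * Eo * (c₁₁ j * rc j + c₁₂ j * rs j)) ^ 2 + (κ * Eo * (c₂₁ j * rc j + c₂₂ j * rs j)) ^ 2 := by ring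
  have eB : (κ * Ei) ^ 2 * ((-(c₁₁ j * rs j) + c₁₂ j * rc j) ^ 2 + (-(c₂₁ j * rs j) + c₂₂ j * rc j) ^ 2) = (κ * Ei * (-(c₁₁ j * rs j) + c₁₂ j * rc j)) ^ 2 + (κ * Ei * (-(c₂₁ j * rs j) + c₂₂ j * rc j)) ^ 2 := by ring
  have eC : (κ * Eo) * (κ * Ei) * ((c₁₁ j * rc j + c₁₂ j * rs j) * (-(c₁₁ j * rs j) + c₁₂ j * rc j) + (c₂₁ j * rc j + c₂₂ j * rs j) * (-(c₂₁ j * rs j) + c₂₂ j * rc j)) =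
      (κ * Eo * (c₁₁ j * rc j + c₁₂ j * rs j)) * (κ * Ei * (-(c₁₁ j * rs j) + c₁₂ j * rc j)) + (κ * Eo * (c₂₁ j * rc j + c₂₂ j * rs j)) * (κ * Ei * (-(c₂₁ j * rs j) + c₂₂ j * rc j)) := by ring
  rw [eA, eB, eC, hgram]
  have hκ2 : κ ^ 2 * Real.exp (2 * lam * W.period) = 1 := by
    rw [hκ, ← Real.exp_nat_mul, ← Real.exp_add, show ((2:ℕ):ℝ) * -(lam * W.period) + 2 * lam * W.period = 0 by push_cast; ring,
      Real.exp_zero]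
  -- the real quadratic form at `ξ = R a` equals `κ²|C_k₀ a|²`
  have hQ : ∀ a₁ a₂ : ℝ, a₁ ^ 2 + a₂ ^ 2 ≤
      ((rc j * a₁ + rs j * a₂) * (κ * Eo * (c₁₁ j * rc j + c₁₂ j * rs j)) + (-rs j * a₁ + rc j * a₂) * (κ * Ei * (-(c₁₁ j * rs j) + c₁₂ j * rc j))) ^ 2 +
        ((rc j * a₁ + rs j * a₂) * (κ * Eo * (c₂₁ j * rc j + c₂₂ j * rs j)) + (-rs j * a₁ + rc j * a₂) * (κ * Ei * (-(c₂₁ j * rs j) + c₂₂ j * rc j))) ^ 2 := by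
    intro a₁ a₂
    have k1 : (rc j * a₁ + rs j * a₂) * (κ * Eo * (c₁₁ j * rc j + c₁₂ j * rs j)) + (-rs j * a₁ + rc j * a₂) * (κ * Ei * (-(c₁₁ j * rs j) + c₁₂ j * rc j)) =
        κ * (c₁₁ ((j : ℕ) + 1) * a₁ + c₁₂ ((j : ℕ) + 1) * a₂) := by
      rw [hC.1, hC.2.1]; ring
    have k2 : (rc j * a₁ + rs j * a₂) * (κ * Eo * (c₂₁ j * rc j + c₂₂ j * rs j)) + (-rs j * a₁ + rc j * a₂) * (κ * Ei * (-(c₂₁ j * rs j) + c₂₂ j * rc j)) =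
        κ * (c₂₁ ((j : ℕ) + 1) * a₁ + c₂₂ ((j : ℕ) + 1) * a₂) := by
      rw [hC.2.2.1, hC.2.2.2]; ring
    rw [k1, k2, hjv, mul_pow, mul_pow, ← mul_add]
    have h := mul_le_mul_of_nonneg_left (hEND a₁ a₂) (sq_nonneg κ)
    rw [← mul_assoc, hκ2, one_mul] at h
    exact h
  have hre : ∀ r z : ℂ, ∀ c : ℝ, ((c : ℂ) * z).re = c * z.re := fun r z c => by simp
  have him : ∀ r z : ℂ, ∀ c : ℝ, ((c : ℂ) * z).im = c * z.im := fun r z c => by simp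
  have h1 := hQ x₁.re x₂.re
  have h2 := hQ x₁.im x₂.im
  simp only [Complex.add_re, Complex.add_im, neg_mul, Complex.neg_re, Complex.neg_im, Complex.re_ofReal_mul,
    Complex.im_ofReal_mul]
  have hy₁ : ‖x₁‖ ^ 2 = x₁.re ^ 2 + x₁.im ^ 2 := by rw [Complex.sq_norm, Complex.normSq_apply]; ring
  have hy₂ : ‖x₂‖ ^ 2 = x₂.re ^ 2 + x₂.im ^ 2 := by rw [Complex.sq_norm, Complex.normSq_apply]; ring
  rw [hy₁, hy₂]
  simp only [neg_mul] at h1 h2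
  linarith [h1, h2]

/-- **JUNCTION: the joint form is continuous across slot boundaries** (`C_{j+1} = C_j R_jᵀ diag(e^{X_o,j}, e^{X_i,j}) R_j`):
the form of slot `j+1` at its start, in frame `j+1`, is (equal to, hence) at most the form of slot `j` at its end, in
frame `j`, on every vector given by its frame-`0` coordinates `x`. -/
theorem comoving_junc (W : LatticeWord k₀) (Λ d0 σo σi g₁ rc rs : Fin k₀ → ℝ) (lam : ℝ) (c₁₁ c₁₂ c₂₁ c₂₂ : ℕ → ℝ)
    (hrot : ∀ j, rc j ^ 2 + rs j ^ 2 = 1)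
    (hCsucc : ∀ j : Fin k₀, c₁₁ ((j : ℕ) + 1) = c₁₁ j * (rc j ^ 2 * Real.exp (Λ j * (d0 j * (W.phase j).τ + σo j * g₁ j ^ 2 * ((W.phase j).τ * (1 - 4 * W.ramp / 3)))) + rs j ^ 2 * Real.exp (Λ j * (d0 j * (W.phase j).τ + σi j * g₁ j ^ 2 * ((W.phase j).τ * (1 - 4 * W.ramp / 3))))) + c₁₂ j * (rc j * rs j * (Real.exp (Λ j * (d0 j * (W.phase j).τ + σo j * g₁ j ^ 2 * ((W.phase j).τ * (1 - 4 * W.ramp / 3)))) - Real.exp (Λ j * (d0 j * (W.phase j).τ + σi j * g₁ j ^ 2 * ((W.phase j).τ * (1 - 4 * W.ramp / 3)))))) ∧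
        c₁₂ ((j : ℕ) + 1) = c₁₁ j * (rc j * rs j * (Real.exp (Λ j * (d0 j * (W.phase j).τ + σo j * g₁ j ^ 2 * ((W.phase j).τ * (1 - 4 * W.ramp / 3)))) - Real.exp (Λ j * (d0 j * (W.phase j).τ + σi j * g₁ j ^ 2 * ((W.phase j).τ * (1 - 4 * W.ramp / 3)))))) + c₁₂ j * (rs j ^ 2 * Real.exp (Λ j * (d0 j * (W.phase j).τ + σo j * g₁ j ^ 2 * ((W.phase j).τ * (1 - 4 * W.ramp / 3)))) + rc j ^ 2 * Real.exp (Λ j * (d0 j * (W.phase j).τ + σi j * g₁ j ^ 2 * ((W.phase j).τ * (1 - 4 * W.ramp / 3))))) ∧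
        c₂₁ ((j : ℕ) + 1) = c₂₁ j * (rc j ^ 2 * Real.exp (Λ j * (d0 j * (W.phase j).τ + σo j * g₁ j ^ 2 * ((W.phase j).τ * (1 - 4 * W.ramp / 3)))) + rs j ^ 2 * Real.exp (Λ j * (d0 j * (W.phase j).τ + σi j * g₁ j ^ 2 * ((W.phase j).τ * (1 - 4 * W.ramp / 3))))) + c₂₂ j * (rc j * rs j * (Real.exp (Λ j * (d0 j * (W.phase j).τ + σo j * g₁ j ^ 2 * ((W.phase j).τ * (1 - 4 * W.ramp / 3)))) - Real.exp (Λ j * (d0 j * (W.phase j).τ + σi j * g₁ j ^ 2 * ((W.phase j).τ * (1 - 4 * W.ramp / 3)))))) ∧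
        c₂₂ ((j : ℕ) + 1) = c₂₁ j * (rc j * rs j * (Real.exp (Λ j * (d0 j * (W.phase j).τ + σo j * g₁ j ^ 2 * ((W.phase j).τ * (1 - 4 * W.ramp / 3)))) - Real.exp (Λ j * (d0 j * (W.phase j).τ + σi j * g₁ j ^ 2 * ((W.phase j).τ * (1 - 4 * W.ramp / 3)))))) + c₂₂ j * (rs j ^ 2 * Real.exp (Λ j * (d0 j * (W.phase j).τ + σo j * g₁ j ^ 2 * ((W.phase j).τ * (1 - 4 * W.ramp / 3)))) + rc j ^ 2 * Real.exp (Λ j * (d0 j * (W.phase j).τ + σi j * g₁ j ^ 2 * ((W.phase j).τ * (1 - 4 * W.ramp / 3)))))) :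
    ∀ q : ℕ, ∀ j : Fin k₀, ∀ hj : (j : ℕ) + 1 < k₀, ∀ x₁ x₂ : ℂ,
      Real.exp (-(2 * lam * (((q : ℝ) * W.period + W.start (⟨(j : ℕ) + 1, hj⟩ : Fin k₀)) - (q : ℝ) * W.period)) + 2 * (Λ (⟨(j : ℕ) + 1, hj⟩ : Fin k₀) * (d0 (⟨(j : ℕ) + 1, hj⟩ : Fin k₀) * (((q : ℝ) * W.period + W.start (⟨(j : ℕ) + 1, hj⟩ : Fin k₀)) - ((q : ℝ) * W.period + W.start (⟨(j : ℕ) + 1, hj⟩ : Fin k₀))) + σo (⟨(j : ℕ) + 1, hj⟩ : Fin k₀) * g₁ (⟨(j : ℕ) + 1, hj⟩ : Fin k₀) ^ 2 * (∫ s in (0:ℝ)..(((q : ℝ) * W.period + W.start (⟨(j : ℕ) + 1, hj⟩ : Fin k₀)) - ((q : ℝ) * W.period + W.start (⟨(j : ℕ) + 1, hj⟩ : Fin k₀))), LatticeWord.trapezoid 0 (W.phase (⟨(j : ℕ) + 1, hj⟩ : Fin k₀)).τ W.ramp s ^ 2)))) * ((c₁₁ (⟨(j : ℕ) + 1, hj⟩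 : Fin k₀) * rc (⟨(j : ℕ) + 1, hj⟩ : Fin k₀) + c₁₂ (⟨(j : ℕ) + 1, hj⟩ : Fin k₀) * rs (⟨(j : ℕ) + 1, hj⟩ : Fin k₀)) ^ 2 + (c₂₁ (⟨(j : ℕ) + 1, hj⟩ : Fin k₀) * rc (⟨(j : ℕ) + 1, hj⟩ : Fin k₀) + c₂₂ (⟨(j : ℕ) + 1, hj⟩ : Fin k₀) * rs (⟨(j : ℕ) + 1, hj⟩ : Fin k₀)) ^ 2) * ‖(rc (⟨(j : ℕ) + 1, hj⟩ : Fin k₀) : ℂ) * x₁ + (rs (⟨(j : ℕ) + 1, hj⟩ : Fin k₀) : ℂ) * x₂‖ ^ 2 +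
          Real.exp (-(2 * lam * (((q : ℝ) * W.period + W.start (⟨(j : ℕ) + 1, hj⟩ : Fin k₀)) - (q : ℝ) * W.period)) + 2 * (Λ (⟨(j : ℕ) + 1, hj⟩ : Fin k₀) * (d0 (⟨(j : ℕ) + 1, hj⟩ : Fin k₀) * (((q : ℝ) * W.period + W.start (⟨(j : ℕ) + 1, hj⟩ : Fin k₀)) - ((q : ℝ) * W.period + W.start (⟨(j : ℕ) + 1, hj⟩ : Fin k₀))) + σi (⟨(j : ℕ) + 1, hj⟩ : Fin k₀) * g₁ (⟨(j : ℕ) + 1, hj⟩ : Fin k₀) ^ 2 * (∫ s in (0:ℝ)..(((q : ℝ) * W.period + W.start (⟨(j : ℕ) + 1, hj⟩ : Fin k₀)) - ((q : ℝ) * W.period + W.start (⟨(j : ℕ) + 1, hj⟩ : Fin k₀))), LatticeWord.trapezoid 0 (W.phase (⟨(j : ℕ) + 1, hj⟩ : Fin k₀)).τ W.ramp s ^ 2)))) * ((-(c₁₁ (⟨(j : ℕ) + 1, hj⟩ : Fin k₀) * rs (⟨(j : ℕ) + 1, hj⟩ : Fin k₀)) + c₁₂ (⟨(j : ℕ) +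 1, hj⟩ : Fin k₀) * rc (⟨(j : ℕ) + 1, hj⟩ : Fin k₀)) ^ 2 + (-(c₂₁ (⟨(j : ℕ) + 1, hj⟩ : Fin k₀) * rs (⟨(j : ℕ) + 1, hj⟩ : Fin k₀)) + c₂₂ (⟨(j : ℕ) + 1, hj⟩ : Fin k₀) * rc (⟨(j : ℕ) + 1, hj⟩ : Fin k₀)) ^ 2) * ‖-(rs (⟨(j : ℕ) + 1, hj⟩ : Fin k₀) : ℂ) * x₁ + (rc (⟨(j : ℕ) + 1, hj⟩ : Fin k₀) : ℂ) * x₂‖ ^ 2 +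
          2 * ((((Real.exp (-(2 * lam * (((q : ℝ) * W.period + W.start (⟨(j : ℕ) + 1, hj⟩ : Fin k₀)) - (q : ℝ) * W.period)) + (Λ (⟨(j : ℕ) + 1, hj⟩ : Fin k₀) * (d0 (⟨(j : ℕ) + 1, hj⟩ : Fin k₀) * (((q : ℝ) * W.period + W.start (⟨(j : ℕ) + 1, hj⟩ : Fin k₀)) - ((q : ℝ) * W.period + W.start (⟨(j : ℕ) + 1, hj⟩ : Fin k₀))) + σo (⟨(j : ℕ) + 1, hj⟩ : Fin k₀) * g₁ (⟨(j : ℕ) + 1, hj⟩ : Fin k₀) ^ 2 * (∫ s in (0:ℝ)..(((q : ℝ) * W.period + W.start (⟨(j : ℕ) + 1, hj⟩ : Fin k₀)) - ((q : ℝ) * W.period + W.start (⟨(j : ℕ) + 1, hj⟩ : Fin k₀))), LatticeWord.trapezoid 0 (W.phase (⟨(j : ℕ) + 1, hj⟩ : Fin k₀)).τ W.ramp s ^ 2))) + (Λ (⟨(j : ℕ) + 1, hj⟩ : Fin k₀) * (d0 (⟨(j : ℕ) + 1, hj⟩ : Fin k₀) * (((q : ℝ) * W.period + W.start (⟨(j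 : ℕ) + 1, hj⟩ : Fin k₀)) - ((q : ℝ) * W.period + W.start (⟨(j : ℕ) + 1, hj⟩ : Fin k₀))) + σi (⟨(j : ℕ) + 1, hj⟩ : Fin k₀) * g₁ (⟨(j : ℕ) + 1, hj⟩ : Fin k₀) ^ 2 * (∫ s in (0:ℝ)..(((q : ℝ) * W.period + W.start (⟨(j : ℕ) + 1, hj⟩ : Fin k₀)) - ((q : ℝ) * W.period + W.start (⟨(j : ℕ) + 1, hj⟩ : Fin k₀))), LatticeWord.trapezoid 0 (W.phase (⟨(j : ℕ) + 1, hj⟩ : Fin k₀)).τ W.ramp s ^ 2)))) * ((c₁₁ (⟨(j : ℕ) + 1, hj⟩ : Fin k₀) * rc (⟨(j : ℕ) + 1, hj⟩ : Fin k₀) + c₁₂ (⟨(j : ℕ) + 1, hj⟩ : Fin k₀) * rs (⟨(j : ℕ) + 1, hj⟩ : Fin k₀)) * (-(c₁₁ (⟨(j : ℕ) + 1, hj⟩ : Fin k₀) * rs (⟨(j : ℕ) + 1, hj⟩ : Fin k₀)) + c₁₂ (⟨(j : ℕ) + 1, hj⟩ : Fin k₀) * rc (⟨(j : ℕ) + 1,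 hj⟩ : Fin k₀)) + (c₂₁ (⟨(j : ℕ) + 1, hj⟩ : Fin k₀) * rc (⟨(j : ℕ) + 1, hj⟩ : Fin k₀) + c₂₂ (⟨(j : ℕ) + 1, hj⟩ : Fin k₀) * rs (⟨(j : ℕ) + 1, hj⟩ : Fin k₀)) * (-(c₂₁ (⟨(j : ℕ) + 1, hj⟩ : Fin k₀) * rs (⟨(j : ℕ) + 1, hj⟩ : Fin k₀)) + c₂₂ (⟨(j : ℕ) + 1, hj⟩ : Fin k₀) * rc (⟨(j : ℕ) + 1, hj⟩ : Fin k₀)))) : ℝ) : ℂ) * conj ((rc (⟨(j : ℕ) + 1, hj⟩ : Fin k₀) : ℂ) * x₁ + (rs (⟨(j : ℕ) + 1, hj⟩ : Fin k₀) : ℂ) * x₂) * (-(rs (⟨(j : ℕ) + 1, hj⟩ : Fin k₀) : ℂ) * x₁ + (rc (⟨(j : ℕ) + 1, hj⟩ : Fin k₀) : ℂ) * x₂)).re ≤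
      Real.exp (-(2 * lam * (((q : ℝ) * W.period + W.start j + (W.phase j).τ) - (q : ℝ) * W.period)) + 2 * (Λ j * (d0 j * (((q : ℝ) * W.period + W.start j + (W.phase j).τ) - ((q : ℝ) * W.period + W.start j)) + σo j * g₁ j ^ 2 * (∫ s in (0:ℝ)..(((q : ℝ) * W.period + W.start j + (W.phase j).τ) - ((q : ℝ) * W.period + W.start j)), LatticeWord.trapezoid 0 (W.phase j).τ W.ramp s ^ 2)))) * ((c₁₁ j * rc j + c₁₂ j * rs j) ^ 2 + (c₂₁ j * rc j + c₂₂ j * rs j) ^ 2) * ‖(rc j : ℂ) * x₁ + (rs j : ℂ) * x₂‖ ^ 2 +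
          Real.exp (-(2 * lam * (((q : ℝ) * W.period + W.start j + (W.phase j).τ) - (q : ℝ) * W.period)) + 2 * (Λ j * (d0 j * (((q : ℝ) * W.period + W.start j + (W.phase j).τ) - ((q : ℝ) * W.period + W.start j)) + σi j * g₁ j ^ 2 * (∫ s in (0:ℝ)..(((q : ℝ) * W.period + W.start j + (W.phase j).τ) - ((q : ℝ) * W.period + W.start j)), LatticeWord.trapezoid 0 (W.phase j).τ W.ramp s ^ 2)))) * ((-(c₁₁ j * rs j) + c₁₂ j * rc j) ^ 2 + (-(c₂₁ j * rs j) + c₂₂ j * rc j) ^ 2) * ‖-(rs j : ℂ) * x₁ + (rc j : ℂ) * x₂‖ ^ 2 +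
          2 * ((((Real.exp (-(2 * lam * (((q : ℝ) * W.period + W.start j + (W.phase j).τ) - (q : ℝ) * W.period)) + (Λ j * (d0 j * (((q : ℝ) * W.period + W.start j + (W.phase j).τ) - ((q : ℝ) * W.period + W.start j)) + σo j * g₁ j ^ 2 * (∫ s in (0:ℝ)..(((q : ℝ) * W.period + W.start j + (W.phase j).τ) - ((q : ℝ) * W.period + W.start j)), LatticeWord.trapezoid 0 (W.phase j).τ W.ramp s ^ 2))) + (Λ j * (d0 j * (((q : ℝ) * W.period + W.start j + (W.phase j).τ) - ((q : ℝ) * W.period + W.start j)) + σi j * g₁ j ^ 2 * (∫ s in (0:ℝ)..(((q : ℝ) * W.period + W.start j + (W.phase j).τ) - ((q : ℝ) * W.period + W.start j)), LatticeWord.trapezoid 0 (W.phase j).τ W.ramp s ^ 2)))) * ((c₁₁ j * rc j + c₁₂ j * rs j) * (-(c₁₁ j * rs j) + c₁₂ j * rc j) + (c₂₁ j * rc j + c₂₂ j * rs j) * (-(c₂₁ j * rs j) + c₂₂ j * rc j))) : ℝ) : ℂ) * conj ((rc j : ℂ) * x₁ + (rs j : ℂ) * x₂) * (-(rs j : ℂ)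 * x₁ + (rc j : ℂ) * x₂)).re := by
  intro q j hj x₁ x₂
  have hτ := (W.phase j).τ_pos
  have hst : W.start (⟨(j : ℕ) + 1, hj⟩ : Fin k₀) = W.start j + (W.phase j).τ := by
    rw [start_eq_sum_range W ((j : ℕ) + 1) hj, Finset.sum_range_succ, dif_pos j.isLt, ← start_eq_sum_range W j j.isLt]
  have hv1 : (((⟨(j : ℕ) + 1, hj⟩ : Fin k₀) : ℕ)) = (j : ℕ) + 1 := rfl
  -- the left side: `r = 0`; the right side: `r = τ_j`
  have htL : ((q : ℝ) * W.period + W.start (⟨(j : ℕ) + 1, hj⟩ : Fin k₀)) - (q : ℝ) * W.period = W.start j + (W.phase j).τ := by rw [hst]; ring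
  have ht1 : ((q : ℝ) * W.period + W.start j + (W.phase j).τ) - ((q : ℝ) * W.period + W.start j) = (W.phase j).τ := by ring
  have ht2 : ((q : ℝ) * W.period + W.start j + (W.phase j).τ) - (q : ℝ) * W.period = W.start j + (W.phase j).τ := by ring
  rw [sub_self, intervalIntegral.integral_same, htL, hv1, ht1, ht2, integral_trapezoid_sq hτ W.ramp_pos W.ramp_le]
  obtain ⟨Xo, hXo⟩ : ∃ X : ℝ, X = Λ j * (d0 j * (W.phase j).τ + σo j * g₁ j ^ 2 * ((W.phase j).τ * (1 - 4 * W.ramp / 3))) :=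
    ⟨_, rfl⟩
  obtain ⟨Xi, hXi⟩ : ∃ X : ℝ, X = Λ j * (d0 j * (W.phase j).τ + σi j * g₁ j ^ 2 * ((W.phase j).τ * (1 - 4 * W.ramp / 3))) :=
    ⟨_, rfl⟩
  have hC := hCsucc j
  rw [← hXo, ← hXi] at hC ⊢
  obtain ⟨sP, hsP⟩ : ∃ s : ℝ, s = W.start j + (W.phase j).τ := ⟨_, rfl⟩
  rw [← hsP]
  obtain ⟨κ, hκ⟩ : ∃ κ : ℝ, κ = Real.exp (-(lam * sP)) := ⟨_, rfl⟩
  obtain ⟨Eo, hEo⟩ : ∃ Eo : ℝ, Eo = Real.exp Xo := ⟨_, rfl⟩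
  obtain ⟨Ei, hEi⟩ : ∃ Ei : ℝ, Ei = Real.exp Xi := ⟨_, rfl⟩
  have e0 : Real.exp (-(2 * lam * sP) + 2 * (Λ (⟨(j : ℕ) + 1, hj⟩ : Fin k₀) * (d0 (⟨(j : ℕ) + 1, hj⟩ : Fin k₀) * 0 + σo (⟨(j : ℕ) + 1, hj⟩ : Fin k₀) * g₁ (⟨(j : ℕ) + 1, hj⟩ : Fin k₀) ^ 2 * 0))) = κ ^ 2 := by
    rw [hκ, ← Real.exp_nat_mul]; congr 1; push_cast; ring
  have e0' : Real.exp (-(2 * lam * sP) + 2 * (Λ (⟨(j : ℕ) + 1, hj⟩ : Fin k₀) * (d0 (⟨(j : ℕ) + 1, hj⟩ : Fin k₀) * 0 + σi (⟨(j : ℕ) + 1, hj⟩ : Fin k₀) * g₁ (⟨(j : ℕ) + 1, hj⟩ : Fin k₀) ^ 2 * 0))) = κ ^ 2 := by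
    rw [hκ, ← Real.exp_nat_mul]; congr 1; push_cast; ring
  have e0'' : Real.exp (-(2 * lam * sP) + Λ (⟨(j : ℕ) + 1, hj⟩ : Fin k₀) * (d0 (⟨(j : ℕ) + 1, hj⟩ : Fin k₀) * 0 + σo (⟨(j : ℕ) + 1, hj⟩ : Fin k₀) * g₁ (⟨(j : ℕ) + 1, hj⟩ : Fin k₀) ^ 2 * 0) +
      Λ (⟨(j : ℕ) + 1, hj⟩ : Fin k₀) * (d0 (⟨(j : ℕ) + 1, hj⟩ : Fin k₀) * 0 + σi (⟨(j : ℕ) + 1, hj⟩ : Fin k₀) * g₁ (⟨(j : ℕ) + 1, hj⟩ : Fin k₀) ^ 2 * 0)) = κ * κ := by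
    rw [hκ, ← Real.exp_add]; congr 1; ring
  have e1 : Real.exp (-(2 * lam * sP) + 2 * Xo) = (κ * Eo) ^ 2 := by
    rw [hκ, hEo, mul_pow, ← Real.exp_nat_mul, ← Real.exp_nat_mul, ← Real.exp_add]; congr 1; push_cast; ring
  have e2 : Real.exp (-(2 * lam * sP) + 2 * Xi) = (κ * Ei) ^ 2 := by
    rw [hκ, hEi, mul_pow, ← Real.exp_nat_mul, ← Real.exp_nat_mul, ← Real.exp_add]; congr 1; push_cast; ring
  have e3 : Real.exp (-(2 * lam * sP) + Xo + Xi) = (κ * Eo) * (κ * Ei) := by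
    rw [hκ, hEo, hEi, show -(2 * lam * sP) + Xo + Xi = (-(lam * sP) + Xo) + (-(lam * sP) + Xi) by ring,
      Real.exp_add, Real.exp_add, Real.exp_add]
  rw [← hEo, ← hEi] at hC
  rw [e0, e0', e0'', e1, e2, e3]
  -- both sides as Gram forms
  have hgramL := pairForm_gram (κ * (c₁₁ ((j : ℕ) + 1) * rc (⟨(j : ℕ) + 1, hj⟩ : Fin k₀) + c₁₂ ((j : ℕ) + 1) * rs (⟨(j : ℕ) + 1, hj⟩ : Fin k₀))) (κ * (c₂₁ ((j : ℕ) + 1) * rc (⟨(j : ℕ) + 1, hj⟩ : Fin k₀) + c₂₂ ((j : ℕ) + 1) * rs (⟨(j : ℕ) + 1, hj⟩ : Fin k₀))) (κ * (-(c₁₁ ((j : ℕ) + 1) * rs (⟨(j : ℕ) + 1, hj⟩ : Fin k₀)) + c₁₂ ((j : ℕ) + 1) * rc (⟨(j : ℕ) + 1, hj⟩ : Fin k₀))) (κ * (-(c₂₁ ((j : ℕ) + 1) * rs (⟨(j : ℕ) + 1, hj⟩ : Fin k₀)) + c₂₂ ((j : ℕ) + 1) * rc (⟨(j : ℕ) +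 1, hj⟩ : Fin k₀)))
    ((rc (⟨(j : ℕ) + 1, hj⟩ : Fin k₀) : ℂ) * x₁ + (rs (⟨(j : ℕ) + 1, hj⟩ : Fin k₀) : ℂ) * x₂) (-(rs (⟨(j : ℕ) + 1, hj⟩ : Fin k₀) : ℂ) * x₁ + (rc (⟨(j : ℕ) + 1, hj⟩ : Fin k₀) : ℂ) * x₂)
  have eAL : κ ^ 2 * ((c₁₁ ((j : ℕ) + 1) * rc (⟨(j : ℕ) + 1, hj⟩ : Fin k₀) + c₁₂ ((j : ℕ) + 1) * rs (⟨(j : ℕ) + 1, hj⟩ : Fin k₀)) ^ 2 + (c₂₁ ((j : ℕ) + 1) * rc (⟨(j : ℕ) + 1, hj⟩ : Fin k₀) + c₂₂ ((j : ℕ) + 1) * rs (⟨(j : ℕ) + 1, hj⟩ : Fin k₀)) ^ 2) = (κ * (c₁₁ ((j : ℕ) + 1) * rc (⟨(j : ℕ) + 1, hj⟩ : Fin k₀) + c₁₂ ((j : ℕ) + 1) * rs (⟨(j : ℕ) + 1, hj⟩ : Fin k₀))) ^ 2 + (κ * (c₂₁ ((j : ℕ) + 1) * rc (⟨(j : ℕ)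 + 1, hj⟩ : Fin k₀) + c₂₂ ((j : ℕ) + 1) * rs (⟨(j : ℕ) + 1, hj⟩ : Fin k₀))) ^ 2 := by ring
  have eBL : κ ^ 2 * ((-(c₁₁ ((j : ℕ) + 1) * rs (⟨(j : ℕ) + 1, hj⟩ : Fin k₀)) + c₁₂ ((j : ℕ) + 1) * rc (⟨(j : ℕ) + 1, hj⟩ : Fin k₀)) ^ 2 + (-(c₂₁ ((j : ℕ) + 1) * rs (⟨(j : ℕ) + 1, hj⟩ : Fin k₀)) + c₂₂ ((j : ℕ) + 1) * rc (⟨(j : ℕ) + 1, hj⟩ : Fin k₀)) ^ 2) = (κ * (-(c₁₁ ((j : ℕ) + 1) * rs (⟨(j : ℕ) + 1, hj⟩ : Fin k₀)) + c₁₂ ((j : ℕ) + 1) * rc (⟨(j : ℕ) + 1, hj⟩ : Fin k₀))) ^ 2 + (κ * (-(c₂₁ ((j : ℕ) + 1) * rs (⟨(j : ℕ) + 1, hj⟩ : Fin k₀)) + c₂₂ ((j : ℕ) + 1) * rc (⟨(j : ℕ) + 1, hj⟩ : Fin k₀))) ^ 2 := by ring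
  have eCL : κ * κ * ((c₁₁ ((j : ℕ) + 1) * rc (⟨(j : ℕ) + 1, hj⟩ : Fin k₀) + c₁₂ ((j : ℕ) + 1) * rs (⟨(j : ℕ) + 1, hj⟩ : Fin k₀)) * (-(c₁₁ ((j : ℕ) + 1) * rs (⟨(j : ℕ) + 1, hj⟩ : Fin k₀)) + c₁₂ ((j : ℕ) + 1) * rc (⟨(j : ℕ) + 1, hj⟩ : Fin k₀)) + (c₂₁ ((j : ℕ) + 1) * rc (⟨(j : ℕ) + 1, hj⟩ : Fin k₀) + c₂₂ ((j : ℕ) + 1) * rs (⟨(j : ℕ) + 1, hj⟩ : Fin k₀)) * (-(c₂₁ ((j : ℕ) + 1) * rs (⟨(j : ℕ) + 1, hj⟩ : Fin k₀)) + c₂₂ ((j : ℕ) + 1) * rc (⟨(j : ℕ) + 1, hj⟩ : Fin k₀))) = (κ * (c₁₁ ((j : ℕ) + 1) * rc (⟨(j : ℕ) + 1, hj⟩ : Fin k₀) + c₁₂ ((j : ℕ) + 1) * rs (⟨(j : ℕ) + 1, hj⟩ : Fin k₀))) * (κ * (-(c₁₁ ((j : ℕ) + 1) * rs (⟨(j :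 ℕ) + 1, hj⟩ : Fin k₀)) + c₁₂ ((j : ℕ) + 1) * rc (⟨(j : ℕ) + 1, hj⟩ : Fin k₀))) + (κ * (c₂₁ ((j : ℕ) + 1) * rc (⟨(j : ℕ) + 1, hj⟩ : Fin k₀) + c₂₂ ((j : ℕ) + 1) * rs (⟨(j : ℕ) + 1, hj⟩ : Fin k₀))) * (κ * (-(c₂₁ ((j : ℕ) + 1) * rs (⟨(j : ℕ) + 1, hj⟩ : Fin k₀)) + c₂₂ ((j : ℕ) + 1) * rc (⟨(j : ℕ) + 1, hj⟩ : Fin k₀))) := by ring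
  have hgramR := pairForm_gram (κ * Eo * (c₁₁ j * rc j + c₁₂ j * rs j)) (κ * Eo * (c₂₁ j * rc j + c₂₂ j * rs j)) (κ * Ei * (-(c₁₁ j * rs j) + c₁₂ j * rc j)) (κ * Ei * (-(c₂₁ j * rs j) + c₂₂ j * rc j))
    ((rc j : ℂ) * x₁ + (rs j : ℂ) * x₂) (-(rs j : ℂ) * x₁ + (rc j : ℂ) * x₂)
  have eA : (κ * Eo) ^ 2 * ((c₁₁ j * rc j + c₁₂ j * rs j) ^ 2 + (c₂₁ j * rc j + c₂₂ j * rs j) ^ 2) = (κ * Eo * (c₁₁ j * rc j + c₁₂ j * rs j)) ^ 2 + (κ * Eo * (c₂₁ j * rc j + c₂₂ j * rs j)) ^ 2 := by ring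
  have eB : (κ * Ei) ^ 2 * ((-(c₁₁ j * rs j) + c₁₂ j * rc j) ^ 2 + (-(c₂₁ j * rs j) + c₂₂ j * rc j) ^ 2) = (κ * Ei * (-(c₁₁ j * rs j) + c₁₂ j * rc j)) ^ 2 + (κ * Ei * (-(c₂₁ j * rs j) + c₂₂ j * rc j)) ^ 2 := by ring
  have eC : (κ * Eo) * (κ * Ei) * ((c₁₁ j * rc j + c₁₂ j * rs j) * (-(c₁₁ j * rs j) + c₁₂ j * rc j) + (c₂₁ j * rc j + c₂₂ j * rs j) * (-(c₂₁ j * rs j) + c₂₂ j * rc j)) =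
      (κ * Eo * (c₁₁ j * rc j + c₁₂ j * rs j)) * (κ * Ei * (-(c₁₁ j * rs j) + c₁₂ j * rc j)) + (κ * Eo * (c₂₁ j * rc j + c₂₂ j * rs j)) * (κ * Ei * (-(c₂₁ j * rs j) + c₂₂ j * rc j)) := by ring
  rw [eAL, eBL, eCL, hgramL, eA, eB, eC, hgramR]
  simp only [Complex.add_re, Complex.add_im, neg_mul, Complex.neg_re, Complex.neg_im, Complex.re_ofReal_mul,
    Complex.im_ofReal_mul]
  -- the two real quadratic forms agree: both are `κ²|C_{j+1} a|²`
  have hL : ∀ a₁ a₂ : ℝ, (rc (⟨(j : ℕ) + 1, hj⟩ : Fin k₀) * a₁ + rs (⟨(j : ℕ) + 1, hj⟩ : Fin k₀) * a₂) * (κ * (c₁₁ ((j : ℕ) + 1) * rc (⟨(j : ℕ) + 1, hj⟩ : Fin k₀) + c₁₂ ((j : ℕ) + 1) * rs (⟨(j : ℕ) + 1, hj⟩ : Fin k₀))) + (-(rs (⟨(j : ℕ) + 1, hj⟩ : Fin k₀) * a₁) + rc (⟨(j : ℕ) + 1, hj⟩ : Fin k₀) * a₂) * (κ * (-(c₁₁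 ((j : ℕ) + 1) * rs (⟨(j : ℕ) + 1, hj⟩ : Fin k₀)) + c₁₂ ((j : ℕ) + 1) * rc (⟨(j : ℕ) + 1, hj⟩ : Fin k₀))) =
      κ * (c₁₁ ((j : ℕ) + 1) * a₁ + c₁₂ ((j : ℕ) + 1) * a₂) := by
    intro a₁ a₂; linear_combination κ * (c₁₁ ((j : ℕ) + 1) * a₁ + c₁₂ ((j : ℕ) + 1) * a₂) * hrot (⟨(j : ℕ) + 1, hj⟩ : Fin k₀)
  have hL' : ∀ a₁ a₂ : ℝ, (rc (⟨(j : ℕ) + 1, hj⟩ : Fin k₀) * a₁ + rs (⟨(j : ℕ) + 1, hj⟩ : Fin k₀) * a₂) * (κ * (c₂₁ ((j : ℕ) + 1) * rc (⟨(j : ℕ) + 1, hj⟩ : Fin k₀) + c₂₂ ((j : ℕ) + 1) * rs (⟨(j : ℕ) + 1, hj⟩ : Fin k₀))) + (-(rs (⟨(j : ℕ) + 1, hj⟩ : Fin k₀) * a₁) + rc (⟨(j : ℕ) + 1, hj⟩ : Fin k₀) * a₂) * (κ * (-(c₂₁ ((j : ℕ) + 1) * rs (⟨(j : ℕ) + 1,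 hj⟩ : Fin k₀)) + c₂₂ ((j : ℕ) + 1) * rc (⟨(j : ℕ) + 1, hj⟩ : Fin k₀))) =
      κ * (c₂₁ ((j : ℕ) + 1) * a₁ + c₂₂ ((j : ℕ) + 1) * a₂) := by
    intro a₁ a₂; linear_combination κ * (c₂₁ ((j : ℕ) + 1) * a₁ + c₂₂ ((j : ℕ) + 1) * a₂) * hrot (⟨(j : ℕ) + 1, hj⟩ : Fin k₀)
  have hR : ∀ a₁ a₂ : ℝ, (rc j * a₁ + rs j * a₂) * (κ * Eo * (c₁₁ j * rc j + c₁₂ j * rs j)) + (-(rs j * a₁) + rc j * a₂) * (κ * Ei * (-(c₁₁ j * rs j) + c₁₂ j * rc j)) =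
      κ * (c₁₁ ((j : ℕ) + 1) * a₁ + c₁₂ ((j : ℕ) + 1) * a₂) := by
    intro a₁ a₂; rw [hC.1, hC.2.1]; ring
  have hR' : ∀ a₁ a₂ : ℝ, (rc j * a₁ + rs j * a₂) * (κ * Eo * (c₂₁ j * rc j + c₂₂ j * rs j)) + (-(rs j * a₁) + rc j * a₂) * (κ * Ei * (-(c₂₁ j * rs j) + c₂₂ j * rc j)) =
      κ * (c₂₁ ((j : ℕ) + 1) * a₁ + c₂₂ ((j : ℕ) + 1) * a₂) := by
    intro a₁ a₂; rw [hC.2.2.1, hC.2.2.2]; ring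
  rw [hL, hL', hL, hL', hR, hR', hR, hR']

/-- The full-slot nominal exponents are nonnegative. -/
theorem comoving_X_nonneg (W : LatticeWord k₀) (Λ d0 σ g₁ : Fin k₀ → ℝ) (hΛ : ∀ j, 0 ≤ Λ j) (hd0 : ∀ j, 0 ≤ d0 j)
    (hσ : ∀ j, 0 ≤ σ j) (j : Fin k₀) :
    0 ≤ Λ j * (d0 j * (W.phase j).τ + σ j * g₁ j ^ 2 * ((W.phase j).τ * (1 - 4 * W.ramp / 3))) := by
  have hτ := (W.phase j).τ_pos.le
  have hρ : 0 ≤ 1 - 4 * W.ramp / 3 := by linarith [W.ramp_le]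
  exact mul_nonneg (hΛ j) (add_nonneg (mul_nonneg (hd0 j) hτ)
    (mul_nonneg (mul_nonneg (hσ j) (sq_nonneg _)) (mul_nonneg hτ hρ)))

/-- **The transport matrices are expansive**: `|C_j z|² ≥ |z|²` (every factor `Rᵀ diag(e^{X_o}, e^{X_i}) R` is). -/
theorem comoving_expansive (W : LatticeWord k₀) (Λ d0 σo σi g₁ rc rs : Fin k₀ → ℝ) (c₁₁ c₁₂ c₂₁ c₂₂ : ℕ → ℝ)
    (hΛ : ∀ j, 0 ≤ Λ j) (hd0 : ∀ j, 0 ≤ d0 j) (hσo : ∀ j, 0 ≤ σo j) (hσi : ∀ j, 0 ≤ σi j)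
    (hrot : ∀ j, rc j ^ 2 + rs j ^ 2 = 1) (hC0 : c₁₁ 0 = 1 ∧ c₁₂ 0 = 0 ∧ c₂₁ 0 = 0 ∧ c₂₂ 0 = 1)
    (hCsucc : ∀ j : Fin k₀, c₁₁ ((j : ℕ) + 1) = c₁₁ j * (rc j ^ 2 * Real.exp (Λ j * (d0 j * (W.phase j).τ + σo j * g₁ j ^ 2 * ((W.phase j).τ * (1 - 4 * W.ramp / 3)))) + rs j ^ 2 * Real.exp (Λ j * (d0 j * (W.phase j).τ + σi j * g₁ j ^ 2 * ((W.phase j).τ * (1 - 4 * W.ramp / 3))))) + c₁₂ j * (rc j * rs j * (Real.exp (Λ j * (d0 j * (W.phase j).τ + σo j * g₁ j ^ 2 * ((W.phase j).τ * (1 - 4 * W.ramp / 3)))) - Real.exp (Λ j * (d0 j * (W.phase j).τ + σi j * g₁ j ^ 2 * ((W.phase j).τ * (1 - 4 * W.ramp / 3)))))) ∧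
        c₁₂ ((j : ℕ) + 1) = c₁₁ j * (rc j * rs j * (Real.exp (Λ j * (d0 j * (W.phase j).τ + σo j * g₁ j ^ 2 * ((W.phase j).τ * (1 - 4 * W.ramp / 3)))) - Real.exp (Λ j * (d0 j * (W.phase j).τ + σi j * g₁ j ^ 2 * ((W.phase j).τ * (1 - 4 * W.ramp / 3)))))) + c₁₂ j * (rs j ^ 2 * Real.exp (Λ j * (d0 j * (W.phase j).τ + σo j * g₁ j ^ 2 * ((W.phase j).τ * (1 - 4 * W.ramp / 3)))) + rc j ^ 2 * Real.exp (Λ j * (d0 j * (W.phase j).τ + σi j * g₁ j ^ 2 * ((W.phase j).τ * (1 - 4 * W.ramp / 3))))) ∧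
        c₂₁ ((j : ℕ) + 1) = c₂₁ j * (rc j ^ 2 * Real.exp (Λ j * (d0 j * (W.phase j).τ + σo j * g₁ j ^ 2 * ((W.phase j).τ * (1 - 4 * W.ramp / 3)))) + rs j ^ 2 * Real.exp (Λ j * (d0 j * (W.phase j).τ + σi j * g₁ j ^ 2 * ((W.phase j).τ * (1 - 4 * W.ramp / 3))))) + c₂₂ j * (rc j * rs j * (Real.exp (Λ j * (d0 j * (W.phase j).τ + σo j * g₁ j ^ 2 * ((W.phase j).τ * (1 - 4 * W.ramp / 3)))) - Real.exp (Λ j * (d0 j * (W.phase j).τ + σi j * g₁ j ^ 2 * ((W.phase j).τ * (1 - 4 * W.ramp / 3)))))) ∧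
        c₂₂ ((j : ℕ) + 1) = c₂₁ j * (rc j * rs j * (Real.exp (Λ j * (d0 j * (W.phase j).τ + σo j * g₁ j ^ 2 * ((W.phase j).τ * (1 - 4 * W.ramp / 3)))) - Real.exp (Λ j * (d0 j * (W.phase j).τ + σi j * g₁ j ^ 2 * ((W.phase j).τ * (1 - 4 * W.ramp / 3)))))) + c₂₂ j * (rs j ^ 2 * Real.exp (Λ j * (d0 j * (W.phase j).τ + σo j * g₁ j ^ 2 * ((W.phase j).τ * (1 - 4 * W.ramp / 3)))) + rc j ^ 2 * Real.exp (Λ j * (d0 j * (W.phase j).τ + σi j * g₁ j ^ 2 * ((W.phase j).τ * (1 - 4 * W.ramp / 3)))))) :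
    ∀ m : ℕ, m ≤ k₀ → ∀ z₁ z₂ : ℝ, z₁ ^ 2 + z₂ ^ 2 ≤ (c₁₁ m * z₁ + c₁₂ m * z₂) ^ 2 + (c₂₁ m * z₁ + c₂₂ m * z₂) ^ 2 := by
  intro m
  induction m with
  | zero =>
    intro _ z₁ z₂
    rw [hC0.1, hC0.2.1, hC0.2.2.1, hC0.2.2.2]
    nlinarith
  | succ m ih =>
    intro hm z₁ z₂
    have hm' : m < k₀ := Nat.lt_of_succ_le hm
    have hC := hCsucc ⟨m, hm'⟩
    have hv : (((⟨m, hm'⟩ : Fin k₀) : ℕ)) = m := rfl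
    rw [hv] at hC
    rw [hC.1, hC.2.1, hC.2.2.1, hC.2.2.2]
    exact transport_step_expansive (hrot _) (Real.one_le_exp (comoving_X_nonneg W Λ d0 σo g₁ hΛ hd0 hσo _))
      (Real.one_le_exp (comoving_X_nonneg W Λ d0 σi g₁ hΛ hd0 hσi _)) (ih hm'.le) z₁ z₂

/-- **The transport matrices are bounded**: `|C_m z|² ≤ exp(2Σ_{i<m}(X_o,i + X_i,i))|z|²`. -/
theorem comoving_bounded (W : LatticeWord k₀) (Λ d0 σo σi g₁ rc rs : Fin k₀ → ℝ) (c₁₁ c₁₂ c₂₁ c₂₂ : ℕ → ℝ)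
    (hΛ : ∀ j, 0 ≤ Λ j) (hd0 : ∀ j, 0 ≤ d0 j) (hσo : ∀ j, 0 ≤ σo j) (hσi : ∀ j, 0 ≤ σi j)
    (hrot : ∀ j, rc j ^ 2 + rs j ^ 2 = 1) (hC0 : c₁₁ 0 = 1 ∧ c₁₂ 0 = 0 ∧ c₂₁ 0 = 0 ∧ c₂₂ 0 = 1)
    (hCsucc : ∀ j : Fin k₀, c₁₁ ((j : ℕ) + 1) = c₁₁ j * (rc j ^ 2 * Real.exp (Λ j * (d0 j * (W.phase j).τ + σo j * g₁ j ^ 2 * ((W.phase j).τ * (1 - 4 * W.ramp / 3)))) + rs j ^ 2 * Real.exp (Λ j * (d0 j * (W.phase j).τ + σi j * g₁ j ^ 2 * ((W.phase j).τ * (1 - 4 * W.ramp / 3))))) + c₁₂ j * (rc j * rs j * (Real.exp (Λ j * (d0 j * (W.phase j).τ + σo j * g₁ j ^ 2 * ((W.phase j).τ * (1 - 4 * W.ramp / 3)))) - Real.exp (Λ j * (d0 j * (W.phase j).τ + σi j * g₁ j ^ 2 * ((W.phase j).τ * (1 - 4 * W.ramp / 3)))))) ∧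
        c₁₂ ((j : ℕ) + 1) = c₁₁ j * (rc j * rs j * (Real.exp (Λ j * (d0 j * (W.phase j).τ + σo j * g₁ j ^ 2 * ((W.phase j).τ * (1 - 4 * W.ramp / 3)))) - Real.exp (Λ j * (d0 j * (W.phase j).τ + σi j * g₁ j ^ 2 * ((W.phase j).τ * (1 - 4 * W.ramp / 3)))))) + c₁₂ j * (rs j ^ 2 * Real.exp (Λ j * (d0 j * (W.phase j).τ + σo j * g₁ j ^ 2 * ((W.phase j).τ * (1 - 4 * W.ramp / 3)))) + rc j ^ 2 * Real.exp (Λ j * (d0 j * (W.phase j).τ + σi j * g₁ j ^ 2 * ((W.phase j).τ * (1 - 4 * W.ramp / 3))))) ∧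
        c₂₁ ((j : ℕ) + 1) = c₂₁ j * (rc j ^ 2 * Real.exp (Λ j * (d0 j * (W.phase j).τ + σo j * g₁ j ^ 2 * ((W.phase j).τ * (1 - 4 * W.ramp / 3)))) + rs j ^ 2 * Real.exp (Λ j * (d0 j * (W.phase j).τ + σi j * g₁ j ^ 2 * ((W.phase j).τ * (1 - 4 * W.ramp / 3))))) + c₂₂ j * (rc j * rs j * (Real.exp (Λ j * (d0 j * (W.phase j).τ + σo j * g₁ j ^ 2 * ((W.phase j).τ * (1 - 4 * W.ramp / 3)))) - Real.exp (Λ j * (d0 j * (W.phase j).τ + σi j * g₁ j ^ 2 * ((W.phase j).τ * (1 - 4 * W.ramp / 3)))))) ∧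
        c₂₂ ((j : ℕ) + 1) = c₂₁ j * (rc j * rs j * (Real.exp (Λ j * (d0 j * (W.phase j).τ + σo j * g₁ j ^ 2 * ((W.phase j).τ * (1 - 4 * W.ramp / 3)))) - Real.exp (Λ j * (d0 j * (W.phase j).τ + σi j * g₁ j ^ 2 * ((W.phase j).τ * (1 - 4 * W.ramp / 3)))))) + c₂₂ j * (rs j ^ 2 * Real.exp (Λ j * (d0 j * (W.phase j).τ + σo j * g₁ j ^ 2 * ((W.phase j).τ * (1 - 4 * W.ramp / 3)))) + rc j ^ 2 * Real.exp (Λ j * (d0 j * (W.phase j).τ + σi j * g₁ j ^ 2 * ((W.phase j).τ * (1 - 4 * W.ramp / 3)))))) :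
    ∀ m : ℕ, m ≤ k₀ → ∀ z₁ z₂ : ℝ, (c₁₁ m * z₁ + c₁₂ m * z₂) ^ 2 + (c₂₁ m * z₁ + c₂₂ m * z₂) ^ 2 ≤
      Real.exp (2 * (∑ i ∈ Finset.range m, (if h : i < k₀ then ((Λ (⟨i, h⟩ : Fin k₀) * (d0 (⟨i, h⟩ : Fin k₀) * (W.phase (⟨i, h⟩ : Fin k₀)).τ + σo (⟨i, h⟩ : Fin k₀) * g₁ (⟨i, h⟩ : Fin k₀) ^ 2 * ((W.phase (⟨i, h⟩ : Fin k₀)).τ * (1 - 4 * W.ramp / 3)))) + (Λ (⟨i, h⟩ : Fin k₀) * (d0 (⟨i, h⟩ : Fin k₀) * (W.phase (⟨i, h⟩ : Fin k₀)).τ + σi (⟨i, h⟩ : Fin k₀) * g₁ (⟨i, h⟩ : Fin k₀) ^ 2 * ((W.phase (⟨i, h⟩ : Fin k₀)).τ * (1 - 4 * W.ramp / 3))))) else 0))) * (z₁ ^ 2 + z₂ ^ 2) := by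
  intro m
  induction m with
  | zero =>
    intro _ z₁ z₂
    rw [hC0.1, hC0.2.1, hC0.2.2.1, hC0.2.2.2]
    simp
  | succ m ih =>
    intro hm z₁ z₂
    have hm' : m < k₀ := Nat.lt_of_succ_le hm
    have hC := hCsucc ⟨m, hm'⟩
    have hv : (((⟨m, hm'⟩ : Fin k₀) : ℕ)) = m := rfl
    rw [hv] at hC
    rw [hC.1, hC.2.1, hC.2.2.1, hC.2.2.2, Finset.sum_range_succ, dif_pos hm']
    have hXo := comoving_X_nonneg W Λ d0 σo g₁ hΛ hd0 hσo ⟨m, hm'⟩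
    have hXi := comoving_X_nonneg W Λ d0 σi g₁ hΛ hd0 hσi ⟨m, hm'⟩
    have h := transport_step_bounded (e := Real.exp ((Λ (⟨m, hm'⟩ : Fin k₀) * (d0 (⟨m, hm'⟩ : Fin k₀) * (W.phase (⟨m, hm'⟩ : Fin k₀)).τ + σo (⟨m, hm'⟩ : Fin k₀) * g₁ (⟨m, hm'⟩ : Fin k₀) ^ 2 * ((W.phase (⟨m, hm'⟩ : Fin k₀)).τ * (1 - 4 * W.ramp / 3)))) + (Λ (⟨m, hm'⟩ : Fin k₀) * (d0 (⟨m, hm'⟩ : Fin k₀) * (W.phase (⟨m, hm'⟩ : Fin k₀)).τ + σi (⟨m, hm'⟩ : Fin k₀) * g₁ (⟨m, hm'⟩ : Fin k₀) ^ 2 * ((W.phase (⟨m, hm'⟩ : Fin k₀)).τ * (1 - 4 * W.ramp / 3))))))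
      (hrot ⟨m, hm'⟩) (Real.exp_pos _).le (Real.exp_pos _).le (Real.exp_le_exp.2 (le_add_of_nonneg_right hXi))
      (Real.exp_le_exp.2 (le_add_of_nonneg_left hXo)) (Real.exp_pos _).le (ih hm'.le) z₁ z₂
    refine h.trans (le_of_eq ?_)
    rw [← Real.exp_nat_mul, ← Real.exp_add]
    congr 2
    push_cast
    ring

/-- The transport matrices are bounded by the TOTAL nominal exponent of the period. -/
theorem comoving_bounded_total (W : LatticeWord k₀) (Λ d0 σo σi g₁ rc rs : Fin k₀ → ℝ) (c₁₁ c₁₂ c₂₁ c₂₂ : ℕ → ℝ)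
    (hΛ : ∀ j, 0 ≤ Λ j) (hd0 : ∀ j, 0 ≤ d0 j) (hσo : ∀ j, 0 ≤ σo j) (hσi : ∀ j, 0 ≤ σi j)
    (hrot : ∀ j, rc j ^ 2 + rs j ^ 2 = 1) (hC0 : c₁₁ 0 = 1 ∧ c₁₂ 0 = 0 ∧ c₂₁ 0 = 0 ∧ c₂₂ 0 = 1)
    (hCsucc : ∀ j : Fin k₀, c₁₁ ((j : ℕ) + 1) = c₁₁ j * (rc j ^ 2 * Real.exp (Λ j * (d0 j * (W.phase j).τ + σo j * g₁ j ^ 2 * ((W.phase j).τ * (1 - 4 * W.ramp / 3)))) + rs j ^ 2 * Real.exp (Λ j * (d0 j * (W.phase j).τ + σi j * g₁ j ^ 2 * ((W.phase j).τ * (1 - 4 * W.ramp / 3))))) + c₁₂ j * (rc j * rs j * (Real.exp (Λ j * (d0 j * (W.phase j).τ + σo j * g₁ j ^ 2 * ((W.phase j).τ * (1 - 4 * W.ramp / 3)))) - Real.exp (Λ j * (d0 j * (W.phase j).τ + σi j * g₁ j ^ 2 * ((W.phase j).τ * (1 - 4 * W.ramp / 3)))))) ∧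
        c₁₂ ((j : ℕ) + 1) = c₁₁ j * (rc j * rs j * (Real.exp (Λ j * (d0 j * (W.phase j).τ + σo j * g₁ j ^ 2 * ((W.phase j).τ * (1 - 4 * W.ramp / 3)))) - Real.exp (Λ j * (d0 j * (W.phase j).τ + σi j * g₁ j ^ 2 * ((W.phase j).τ * (1 - 4 * W.ramp / 3)))))) + c₁₂ j * (rs j ^ 2 * Real.exp (Λ j * (d0 j * (W.phase j).τ + σo j * g₁ j ^ 2 * ((W.phase j).τ * (1 - 4 * W.ramp / 3)))) + rc j ^ 2 * Real.exp (Λ j * (d0 j * (W.phase j).τ + σi j * g₁ j ^ 2 * ((W.phase j).τ * (1 - 4 * W.ramp / 3))))) ∧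
        c₂₁ ((j : ℕ) + 1) = c₂₁ j * (rc j ^ 2 * Real.exp (Λ j * (d0 j * (W.phase j).τ + σo j * g₁ j ^ 2 * ((W.phase j).τ * (1 - 4 * W.ramp / 3)))) + rs j ^ 2 * Real.exp (Λ j * (d0 j * (W.phase j).τ + σi j * g₁ j ^ 2 * ((W.phase j).τ * (1 - 4 * W.ramp / 3))))) + c₂₂ j * (rc j * rs j * (Real.exp (Λ j * (d0 j * (W.phase j).τ + σo j * g₁ j ^ 2 * ((W.phase j).τ * (1 - 4 * W.ramp / 3)))) - Real.exp (Λ j * (d0 j * (W.phase j).τ + σi j * g₁ j ^ 2 * ((W.phase j).τ * (1 - 4 * W.ramp / 3)))))) ∧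
        c₂₂ ((j : ℕ) + 1) = c₂₁ j * (rc j * rs j * (Real.exp (Λ j * (d0 j * (W.phase j).τ + σo j * g₁ j ^ 2 * ((W.phase j).τ * (1 - 4 * W.ramp / 3)))) - Real.exp (Λ j * (d0 j * (W.phase j).τ + σi j * g₁ j ^ 2 * ((W.phase j).τ * (1 - 4 * W.ramp / 3)))))) + c₂₂ j * (rs j ^ 2 * Real.exp (Λ j * (d0 j * (W.phase j).τ + σo j * g₁ j ^ 2 * ((W.phase j).τ * (1 - 4 * W.ramp / 3)))) + rc j ^ 2 * Real.exp (Λ j * (d0 j * (W.phase j).τ + σi j * g₁ j ^ 2 * ((W.phase j).τ * (1 - 4 * W.ramp / 3)))))) :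
    ∀ j : Fin k₀, ∀ z₁ z₂ : ℝ, (c₁₁ j * z₁ + c₁₂ j * z₂) ^ 2 + (c₂₁ j * z₁ + c₂₂ j * z₂) ^ 2 ≤
      Real.exp (2 * (∑ i : Fin k₀, ((Λ i * (d0 i * (W.phase i).τ + σo i * g₁ i ^ 2 * ((W.phase i).τ * (1 - 4 * W.ramp / 3)))) + (Λ i * (d0 i * (W.phase i).τ + σi i * g₁ i ^ 2 * ((W.phase i).τ * (1 - 4 * W.ramp / 3))))))) * (z₁ ^ 2 + z₂ ^ 2) := by
  intro j z₁ z₂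
  have h := comoving_bounded W Λ d0 σo σi g₁ rc rs c₁₁ c₁₂ c₂₁ c₂₂ hΛ hd0 hσo hσi hrot hC0 hCsucc j j.isLt.le z₁ z₂
  refine h.trans (mul_le_mul_of_nonneg_right (Real.exp_le_exp.2 (mul_le_mul_of_nonneg_left ?_ (by norm_num))) (by positivity))
  have htot : (∑ i : Fin k₀, ((Λ i * (d0 i * (W.phase i).τ + σo i * g₁ i ^ 2 * ((W.phase i).τ * (1 - 4 * W.ramp / 3)))) + (Λ i * (d0 i * (W.phase i).τ + σi i * g₁ i ^ 2 * ((W.phase i).τ * (1 - 4 * W.ramp / 3)))))) = ∑ i ∈ Finset.range k₀, (if h : i < k₀ then ((Λ (⟨i, h⟩ : Fin k₀) * (d0 (⟨i, h⟩ : Fin k₀) * (W.phase (⟨i, h⟩ : Fin k₀)).τ + σo (⟨i, h⟩ : Fin k₀) * g₁ (⟨i, h⟩ : Fin k₀) ^ 2 * ((W.phase (⟨i, h⟩ : Fin k₀)).τ * (1 - 4 * W.ramp / 3)))) + (Λ (⟨i, h⟩ : Fin k₀) * (d0 (⟨i, h⟩ : Fin k₀) * (W.phase (⟨i, h⟩ :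 Fin k₀)).τ + σi (⟨i, h⟩ : Fin k₀) * g₁ (⟨i, h⟩ : Fin k₀) ^ 2 * ((W.phase (⟨i, h⟩ : Fin k₀)).τ * (1 - 4 * W.ramp / 3))))) else 0) := by
    rw [← Fin.sum_univ_eq_sum_range (fun i' : ℕ => if h : i' < k₀ then ((Λ (⟨i', h⟩ : Fin k₀) * (d0 (⟨i', h⟩ : Fin k₀) * (W.phase (⟨i', h⟩ : Fin k₀)).τ + σo (⟨i', h⟩ : Fin k₀) * g₁ (⟨i', h⟩ : Fin k₀) ^ 2 * ((W.phase (⟨i', h⟩ : Fin k₀)).τ * (1 - 4 * W.ramp / 3)))) + (Λ (⟨i', h⟩ : Fin k₀) * (d0 (⟨i', h⟩ : Fin k₀) * (W.phase (⟨i', h⟩ : Fin k₀)).τ + σi (⟨i', h⟩ : Fin k₀) * g₁ (⟨i', h⟩ : Fin k₀) ^ 2 * ((W.phase (⟨i', h⟩ : Fin k₀)).τ * (1 - 4 * W.ramp / 3))))) else 0) k₀]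
    refine Finset.sum_congr rfl fun i _ => ?_
    simp [i.isLt]
  rw [htot]
  refine Finset.sum_le_sum_of_subset_of_nonneg (Finset.range_subset_range.2 j.isLt.le) fun i _ _ => ?_
  split_ifs with h
  · exact add_nonneg (comoving_X_nonneg W Λ d0 σo g₁ hΛ hd0 hσo _) (comoving_X_nonneg W Λ d0 σi g₁ hΛ hd0 hσi _)
  · exact le_rfl

/-- **Upper bound of the weights**: `a, b, |c| ≤ G_max := exp(4Σ_j(X_o,j + X_i,j))`. -/
theorem comoving_hGmax (W : LatticeWord k₀) (Λ d0 σo σi g₁ rc rs : Fin k₀ → ℝ) (lam : ℝ) (c₁₁ c₁₂ c₂₁ c₂₂ : ℕ → ℝ)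
    (hΛ : ∀ j, 0 ≤ Λ j) (hd0 : ∀ j, 0 ≤ d0 j) (hσo : ∀ j, 0 ≤ σo j) (hσi : ∀ j, 0 ≤ σi j) (hlam : 0 ≤ lam)
    (hrot : ∀ j, rc j ^ 2 + rs j ^ 2 = 1)
    (hCbdd : ∀ j : Fin k₀, ∀ z₁ z₂ : ℝ, (c₁₁ j * z₁ + c₁₂ j * z₂) ^ 2 + (c₂₁ j * z₁ + c₂₂ j * z₂) ^ 2 ≤
      Real.exp (2 * (∑ i : Fin k₀, ((Λ i * (d0 i * (W.phase i).τ + σo i * g₁ i ^ 2 * ((W.phase i).τ * (1 - 4 * W.ramp / 3)))) + (Λ i * (d0 i * (W.phase i).τ + σi i * g₁ i ^ 2 * ((W.phase i).τ * (1 - 4 * W.ramp / 3))))))) * (z₁ ^ 2 + z₂ ^ 2)) :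
    ∀ q : ℕ, ∀ j : Fin k₀, ∀ t ∈ Icc ((q : ℝ) * W.period + W.start j) ((q : ℝ) * W.period + W.start j + (W.phase j).τ),
      Real.exp (-(2 * lam * (t - (q : ℝ) * W.period)) + 2 * (Λ j * (d0 j * (t - ((q : ℝ) * W.period + W.start j)) + σo j * g₁ j ^ 2 * (∫ s in (0:ℝ)..(t - ((q : ℝ) * W.period + W.start j)), LatticeWord.trapezoid 0 (W.phase j).τ W.ramp s ^ 2)))) * ((c₁₁ j * rc j + c₁₂ j * rs j) ^ 2 + (c₂₁ j * rc j + c₂₂ j * rs j) ^ 2) ≤ Real.exp (4 * (∑ i : Fin k₀, ((Λ i * (d0 i * (W.phase i).τ + σo i * g₁ i ^ 2 * ((W.phase i).τ * (1 - 4 * W.ramp / 3)))) + (Λ i * (d0 i * (W.phase i).τ + σi i * g₁ i ^ 2 * ((W.phase i).τ * (1 - 4 * W.ramp / 3))))))) ∧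
      Real.exp (-(2 * lam * (t - (q : ℝ) * W.period)) + 2 * (Λ j * (d0 j * (t - ((q : ℝ) * W.period + W.start j)) + σi j * g₁ j ^ 2 * (∫ s in (0:ℝ)..(t - ((q : ℝ) * W.period + W.start j)), LatticeWord.trapezoid 0 (W.phase j).τ W.ramp s ^ 2)))) * ((-(c₁₁ j * rs j) + c₁₂ j * rc j) ^ 2 + (-(c₂₁ j * rs j) + c₂₂ j * rc j) ^ 2) ≤ Real.exp (4 * (∑ i : Fin k₀, ((Λ i * (d0 i * (W.phase i).τ + σo i * g₁ i ^ 2 * ((W.phase i).τ * (1 - 4 * W.ramp / 3)))) + (Λ i * (d0 i * (W.phase i).τ + σi i * g₁ i ^ 2 * ((W.phase i).τ * (1 - 4 * W.ramp / 3))))))) ∧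
      ‖(((Real.exp (-(2 * lam * (t - (q : ℝ) * W.period)) + (Λ j * (d0 j * (t - ((q : ℝ) * W.period + W.start j)) + σo j * g₁ j ^ 2 * (∫ s in (0:ℝ)..(t - ((q : ℝ) * W.period + W.start j)), LatticeWord.trapezoid 0 (W.phase j).τ W.ramp s ^ 2))) + (Λ j * (d0 j * (t - ((q : ℝ) * W.period + W.start j)) + σi j * g₁ j ^ 2 * (∫ s in (0:ℝ)..(t - ((q : ℝ) * W.period + W.start j)), LatticeWord.trapezoid 0 (W.phase j).τ W.ramp s ^ 2)))) * ((c₁₁ j * rc j + c₁₂ j * rs j) * (-(c₁₁ j * rs j) + c₁₂ j * rc j) + (c₂₁ j * rc j + c₂₂ j * rs j) * (-(c₂₁ j * rs j) + c₂₂ j * rc j))) : ℝ) : ℂ)‖ ≤ Real.exp (4 * (∑ i : Fin k₀, ((Λ i * (d0 i * (W.phase i).τ + σo i * g₁ i ^ 2 * ((W.phase i).τ * (1 - 4 * W.ramp / 3)))) + (Λ i * (d0 i * (W.phase i).τ + σi i * g₁ i ^ 2 * ((W.phase i).τ * (1 - 4 * W.ramp / 3))))))) := by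
  intro q j t ht
  have hτ := (W.phase j).τ_pos
  have hr : t - ((q : ℝ) * W.period + W.start j) ∈ Icc 0 (W.phase j).τ := ⟨by linarith [ht.1], by linarith [ht.2]⟩
  have hF := integral_trapezoid_sq_bounds hτ W.ramp_pos W.ramp_le hr
  obtain ⟨S, hS⟩ : ∃ S : ℝ, S = (∑ i : Fin k₀, ((Λ i * (d0 i * (W.phase i).τ + σo i * g₁ i ^ 2 * ((W.phase i).τ * (1 - 4 * W.ramp / 3)))) + (Λ i * (d0 i * (W.phase i).τ + σi i * g₁ i ^ 2 * ((W.phase i).τ * (1 - 4 * W.ramp / 3)))))) := ⟨_, rfl⟩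
  obtain ⟨Fo, hFo⟩ : ∃ Fo : ℝ, Fo = (∫ s in (0:ℝ)..(t - ((q : ℝ) * W.period + W.start j)), LatticeWord.trapezoid 0 (W.phase j).τ W.ramp s ^ 2) := ⟨_, rfl⟩
  obtain ⟨Io, hIo⟩ : ∃ Io : ℝ, Io = (Λ j * (d0 j * (t - ((q : ℝ) * W.period + W.start j)) + σo j * g₁ j ^ 2 * (∫ s in (0:ℝ)..(t - ((q : ℝ) * W.period + W.start j)), LatticeWord.trapezoid 0 (W.phase j).τ W.ramp s ^ 2))) := ⟨_, rfl⟩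
  obtain ⟨Ii, hIi⟩ : ∃ Ii : ℝ, Ii = (Λ j * (d0 j * (t - ((q : ℝ) * W.period + W.start j)) + σi j * g₁ j ^ 2 * (∫ s in (0:ℝ)..(t - ((q : ℝ) * W.period + W.start j)), LatticeWord.trapezoid 0 (W.phase j).τ W.ramp s ^ 2))) := ⟨_, rfl⟩
  rw [← hS] at hCbdd ⊢
  rw [← hIo, ← hIi]
  rw [← hFo] at hIo hIi hF
  -- `I_k ≤ X_k,j ≤ S`
  have hXoS : (Λ j * (d0 j * (W.phase j).τ + σo j * g₁ j ^ 2 * ((W.phase j).τ * (1 - 4 * W.ramp / 3)))) ≤ S := by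
    rw [hS]
    refine le_trans (le_add_of_nonneg_right (comoving_X_nonneg W Λ d0 σi g₁ hΛ hd0 hσi j)) ?_
    exact Finset.single_le_sum (f := fun i => (Λ i * (d0 i * (W.phase i).τ + σo i * g₁ i ^ 2 * ((W.phase i).τ * (1 - 4 * W.ramp / 3)))) + (Λ i * (d0 i * (W.phase i).τ + σi i * g₁ i ^ 2 * ((W.phase i).τ * (1 - 4 * W.ramp / 3)))))
      (fun i _ => add_nonneg (comoving_X_nonneg W Λ d0 σo g₁ hΛ hd0 hσo i) (comoving_X_nonneg W Λ d0 σi g₁ hΛ hd0 hσi i))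
      (Finset.mem_univ j)
  have hXiS : (Λ j * (d0 j * (W.phase j).τ + σi j * g₁ j ^ 2 * ((W.phase j).τ * (1 - 4 * W.ramp / 3)))) ≤ S := by
    rw [hS]
    refine le_trans (le_add_of_nonneg_left (comoving_X_nonneg W Λ d0 σo g₁ hΛ hd0 hσo j)) ?_
    exact Finset.single_le_sum (f := fun i => (Λ i * (d0 i * (W.phase i).τ + σo i * g₁ i ^ 2 * ((W.phase i).τ * (1 - 4 * W.ramp / 3)))) + (Λ i * (d0 i * (W.phase i).τ + σi i * g₁ i ^ 2 * ((W.phase i).τ * (1 - 4 * W.ramp / 3)))))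
      (fun i _ => add_nonneg (comoving_X_nonneg W Λ d0 σo g₁ hΛ hd0 hσo i) (comoving_X_nonneg W Λ d0 σi g₁ hΛ hd0 hσi i))
      (Finset.mem_univ j)
  have hmono : ∀ σ : ℝ, 0 ≤ σ → Λ j * (d0 j * (t - ((q : ℝ) * W.period + W.start j)) + σ * g₁ j ^ 2 * Fo) ≤
      Λ j * (d0 j * (W.phase j).τ + σ * g₁ j ^ 2 * ((W.phase j).τ * (1 - 4 * W.ramp / 3))) := by
    intro σ hσ
    refine mul_le_mul_of_nonneg_left (add_le_add (mul_le_mul_of_nonneg_left hr.2 (hd0 j))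
      (mul_le_mul_of_nonneg_left hF.2 (mul_nonneg hσ (sq_nonneg _)))) (hΛ j)
  have hIoS : Io ≤ S := by rw [hIo]; exact (hmono _ (hσo j)).trans hXoS
  have hIiS : Ii ≤ S := by rw [hIi]; exact (hmono _ (hσi j)).trans hXiS
  have hIo0 : 0 ≤ Io := by
    rw [hIo]
    exact mul_nonneg (hΛ j) (add_nonneg (mul_nonneg (hd0 j) hr.1)
      (mul_nonneg (mul_nonneg (hσo j) (sq_nonneg _)) hF.1))
  have hS0 : 0 ≤ S := hIo0.trans hIoS
  have hs0 : 0 ≤ t - (q : ℝ) * W.period := by linarith [ht.1, start_nonneg W j]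
  have hls : 0 ≤ lam * (t - (q : ℝ) * W.period) := mul_nonneg hlam hs0
  -- the three factors
  have hv₁ := hCbdd j (rc j) (rs j)
  have hv₂ := hCbdd j (-rs j) (rc j)
  have hn1 : rc j ^ 2 + rs j ^ 2 = 1 := hrot j
  have hn2 : (-rs j) ^ 2 + rc j ^ 2 = 1 := by rw [neg_sq]; linarith [hrot j]
  rw [hn1, mul_one] at hv₁
  rw [hn2, mul_one] at hv₂
  have ev₂ : (c₁₁ j * -rs j + c₁₂ j * rc j) ^ 2 + (c₂₁ j * -rs j + c₂₂ j * rc j) ^ 2 =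
      (-(c₁₁ j * rs j) + c₁₂ j * rc j) ^ 2 + (-(c₂₁ j * rs j) + c₂₂ j * rc j) ^ 2 := by ring
  rw [ev₂] at hv₂
  have hE2 : 0 ≤ Real.exp (2 * S) := (Real.exp_pos _).le
  have e4 : Real.exp (2 * S) * Real.exp (2 * S) = Real.exp (4 * S) := by rw [← Real.exp_add]; ring_nf
  have hA1 : Real.exp (-(2 * lam * (t - (q : ℝ) * W.period)) + 2 * Io) ≤ Real.exp (2 * S) :=
    Real.exp_le_exp.2 (by linarith)
  have hB1 : Real.exp (-(2 * lam * (t - (q : ℝ) * W.period)) + 2 * Ii) ≤ Real.exp (2 * S) :=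
    Real.exp_le_exp.2 (by linarith)
  have hC1 : Real.exp (-(2 * lam * (t - (q : ℝ) * W.period)) + Io + Ii) ≤ Real.exp (2 * S) :=
    Real.exp_le_exp.2 (by linarith)
  refine ⟨?_, ?_, ?_⟩
  · rw [← e4]
    exact mul_le_mul hA1 hv₁ (by positivity) hE2
  · rw [← e4]
    exact mul_le_mul hB1 hv₂ (by positivity) hE2
  · rw [Complex.norm_real, Real.norm_eq_abs, abs_mul, abs_of_pos (Real.exp_pos _), ← e4]
    refine mul_le_mul hC1 ?_ (abs_nonneg _) hE2
    obtain ⟨a₁, ha₁⟩ : ∃ x : ℝ, x = (c₁₁ j * rc j + c₁₂ j * rs j) := ⟨_, rfl⟩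
    obtain ⟨a₂, ha₂⟩ : ∃ x : ℝ, x = (c₂₁ j * rc j + c₂₂ j * rs j) := ⟨_, rfl⟩
    obtain ⟨b₁, hb₁⟩ : ∃ x : ℝ, x = (-(c₁₁ j * rs j) + c₁₂ j * rc j) := ⟨_, rfl⟩
    obtain ⟨b₂, hb₂⟩ : ∃ x : ℝ, x = (-(c₂₁ j * rs j) + c₂₂ j * rc j) := ⟨_, rfl⟩
    rw [← ha₁, ← ha₂] at hv₁
    rw [← hb₁, ← hb₂] at hv₂
    rw [← ha₁, ← ha₂, ← hb₁, ← hb₂]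
    rw [abs_le]
    constructor
    · nlinarith only [sq_nonneg (a₁ + b₁), sq_nonneg (a₂ + b₂), hv₁, hv₂]
    · nlinarith only [sq_nonneg (a₁ - b₁), sq_nonneg (a₂ - b₂), hv₁, hv₂]

end Summit.AnomalousDissipation.AnomalousDissipation.Theorems.SolenoidalFractalHomogenisation.RealisedQuasiStaticCellLaw

end
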